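import Literature.Analysis.FluidPDE.TorusNSSobolevCommutator
import Literature.Analysis.FluidPDE.TorusNSGevreySums
import Literature.Analysis.FunctionSpaces.TorusWienerSobolevInterpolation
import Literature.Analysis.FluidPDE.ExtremeGrowthVorticityControl
import Literature.Analysis.FunctionSpaces.TorusClassicalNSGluing
import HarnessLib

/-!
# The `Ḣ^s` energy inequality above the critical index, `s > 5/2`, on `T³`:
# `d/dt ‖u‖²_{Ḣ^s} ≤ K ‖u‖₂^{(2s−5)/(2s)} ‖u‖_{Ḣ^s}^{(4s+5)/(2s)}` (Robinson–Sadowski–Silva 2012, Lemma 2.2)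

Analysis/FluidPDE support file (theorems only; no definitions, no named facts).
Search for candidate a priori estimates; no regularity claim.

Robinson–Sadowski–Silva 2012, §II, Lemma 2.2 / §VI: for `s > 5/2` the local existence time is
controlled by `‖u₀‖_{H^s}`, and by scaling `T_s(u₀) ≥ c_s ‖u₀‖_{L²}^{(5−2s)/2s} ‖u₀‖_{Ḣ^s}^{−5/2s}`,
whence the blow-up rate (2.3) `‖u(T−t)‖_{Ḣ^s} ≥ c_s ‖u(T−t)‖_{L²}^{(5−2s)/5} t^{−2s/5}`. On the
torus, with mean-zero data, the same bound follows directly from the `Ḣ^s` energy identity, the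
commutator estimate (3.6) `|(B(u,u),Λ^{2s}u)| ≤ c‖u‖²_{Ḣ^s}‖u‖_{F_1}`
(`NSSobolev.abs_tsum_rpow_mul_re_inner_convect_le`, `TorusNSSobolevCommutator`) and Lemma 3.2 at
`r = 1` between the levels `0` and `s` (`Torus.exists_tsum_rpow_mul_norm_le_interpolation`,
`0 < 5/2 < s`): `‖u‖_{F_1} ≤ C_I ‖u‖₂^{(2s−5)/(2s)} ‖u‖_{Ḣ^s}^{5/(2s)}`. This file proves, for
classical solutions of `Torus.IsClassicalNSSolutionOn (Icc a b) ν 0 u p` with mean-zero slices on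
`T³` and every `s > 5/2` (the `H^{2n+2}` majorants of §1 differentiate the full `Ḣ^s` sum termwise
for `n > s`; the unprimed first versions keep the range `5/2 < s < 9/2`), and §V.A ibid. (the
boundary cases `s = 3/2`, `s = 5/2`, §§6–7):

* `NSSobolev.exists_forall_pow_mul_norm_sq_le`, `NSSobolev.hasDerivAt_tsum_rpow_mul_norm_sq_of_lt`,
  `NSSobolev.continuousOn_tsum_rpow_mul_norm_sq_of_lt` (any `n : ℕ`; the `_six` versions are
  `n = 2`) — uniform `|k|^{4n+4}‖û‖² ≤ W` on compact windows, termwise differentiability and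
  continuity of `τ ↦ ∑|k|^{2s}‖û(τ,k)‖²` for `n₀ < 4n + 4 − 2s`;
* `NSSobolev.hsSeminorm_sq_deriv_le_of_gt_five_halves'` — **the energy inequality**
  `X'(t) ≤ −8π²ν Z(t) + K (∫‖u(t)‖²)^{(2s−5)/(4s)} X(t)^{(4s+5)/(4s)}`,
  `X = ∑|k|^{2s}‖û‖²`, `Z = ∑|k|^{2s+2}‖û‖²` — the differential form of RSS Lemma 2.2: the
  lifespan in `Ḣ^s`, `s > 5/2`, is at least `c ‖u₀‖₂^{−(2s−5)/(2s)} ‖u₀‖_{Ḣ^s}^{−5/(2s)}`,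
  uniformly in `ν`;
* `NSSobolev.hsSeminorm_sq_le_of_window_of_gt_five_halves'` — **Lemma 2.2, window form**: if
  `(b − a)(∫‖u(a)‖²)^{(2s−5)/(4s)} X(a)^{5/(4s)} ≤ c₁` then `X ≤ 2^{4s/5} X(a)` on `[a, b]`;
* `NSSobolev.hsSeminorm_sq_blowup_rate_of_gt_five_halves'` — **the rate (2.3)**: if `X` is
  unbounded on `[a, T)` then `X(t) ≥ (c₁/((T − t)(∫‖u(t)‖²)^{(2s−5)/(4s)}))^{4s/5}`, i.e.
  `‖u(t)‖_{Ḣ^s} ≥ c ‖u(t)‖₂^{−(2s−5)/5} (T − t)^{−2s/5}`, for every `ν > 0`;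
* `NSSobolev.hsSeminorm_sq_blowup_rate_of_gt_five_halves_of_not_bddAbove_gradNormSq` — the same
  rate under the classical hypothesis that `‖∇u‖₂` is unbounded on `[a, T)`;
* §6, the boundary case `s = 3/2` (RSS §V.A), with a parameter `0 < ε < 3/2`:
  `NSSobolev.hsSeminorm_sq_deriv_le_three_halves`
  (`X' ≤ −4π²ν X_{5/2} + c ν^{−(1+2ε)} ‖u‖₂^{4ε/3} X^{2+ε/3}`, `X = ‖u‖²_{Ḣ^{3/2}}`),
  `NSSobolev.hsSeminorm_sq_le_of_window_three_halves` (lifespan, window form) and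
  `NSSobolev.hsSeminorm_sq_blowup_rate_three_halves`
  (`X(t) ≥ (c₁ ν^{1+2ε} / ((T − t) ‖u(t)‖₂^{4ε/3}))^{3/(3+ε)}`: a rate as close to
  `‖u‖_{Ḣ^{3/2}} ≳ (T − t)^{−1/2}` as required); the printed parameter `ε_P ∈ (0, 1)` of §V.A
  (interpolation between `Ḣ^{3/2−ε_P}` and `Ḣ^{3/2+ε_P}`) corresponds to `ε = ε_P/(2 − ε_P)`
  here (levels `(3/2 − ε, 5/2)`): all printed exponents, e.g.
  `d/dt‖u‖²_{3/2} ≤ c‖u‖₂^{4ε_P/(3(2−ε_P))}‖u‖_{3/2}^{4+2ε_P/(3(2−ε_P))}` and the rate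
  `t^{−3(2−ε_P)/(4(3−ε_P))}`, become the ones below under this substitution;
* §7, the boundary case `s = 5/2` (RSS §V.A), with a parameter `0 < ε < 5/2`:
  `NSSobolev.hsSeminorm_sq_deriv_le_five_halves`
  (`X' ≤ −4π²ν X_{7/2} + c ν^{−ε/(2+ε)} ‖u‖₂^{4ε/(5(2+ε))} X^{(15+8ε)/(5(2+ε))}`,
  `X = ‖u‖²_{Ḣ^{5/2}}`, via (3.6)), `NSSobolev.hsSeminorm_sq_le_of_window_five_halves` and
  `NSSobolev.hsSeminorm_sq_blowup_rate_five_halves`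
  (`X(t) ≥ (c₁ ν^{ε/(2+ε)} / ((T − t) ‖u(t)‖₂^{4ε/(5(2+ε))}))^{5(2+ε)/(5+3ε)}`: a rate as close
  to `‖u‖_{Ḣ^{5/2}} ≳ (T − t)^{−1}` as required); again `ε = ε_P/(2 − ε_P)` for the printed
  `ε_P ∈ (0, 1)` (interpolation between `Ḣ^{5/2−ε_P}` and `Ḣ^{5/2+ε_P}`; printed
  `d/dt‖u‖²_{5/2} ≤ c‖u‖₂^{4ε_P/(5(4−ε_P))}‖u‖_{5/2}^{3+ε_P/(5(4−ε_P))}` and rate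
  `t^{−5(4−ε_P)/(4(5−ε_P))}`);
* §8: the §6–§7 rates under the classical hypothesis that `‖∇u‖₂` is unbounded on `[a, T)`
  (`…_three_halves_of_not_bddAbove_gradNormSq`, `…_five_halves_of_not_bddAbove_gradNormSq`).

## Mathlib / tree search

Tree: `NSSobolev.abs_tsum_rpow_mul_re_inner_convect_le` ((3.6)), `Torus.exists_tsum_rpow_mul_norm_le_interpolation`
(Lemma 3.2), `IsClassicalNSSolutionOn.re_inner_mFourierCoeff_timeDerivWithin`, `hasSum_sq_norm_mFourierCoeff_complexify`
(Parseval), `NSSobolev.sum_rpow_mul_norm_mul_norm_convect_le` (absolute summability of the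
trilinear family), `hasDerivAt_tsum_of_isPreconnected`. Searched `lean search 'five_halves|Lemma 2.2|t\^{-2s/5}'`: nothing.

## References

* J. C. Robinson, W. Sadowski, R. P. Silva, *Lower bounds on blow up solutions of the
  three-dimensional Navier–Stokes equations in homogeneous Sobolev spaces*, J. Math. Phys. 53
  (2012) 115618, §II Lemma 2.2 and (2.3) (p. 115618-4), §III (3.6) (p. -6), Lemma 3.2 (p. -9),
  §V.A (pp. -10, -11), §VI (pp. -12, -13) (held: paper:doi-10-1063-1-4762841; PDF page = printed
  page + 1). [RobinsonSadowskiSilva2012]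
* J. Benameur, *On the blow-up criterion of 3D Navier–Stokes equations*, J. Math. Anal. Appl.
  371 (2010) 719–727 (the `‖u‖₂`-weighted rate (1.3), cited in RSS §II). [cited through RobinsonSadowskiSilva2012]
-/

noncomputable section

open MeasureTheory Set Filter UnitAddTorus Function Finset
open scoped Topology BigOperators InnerProductSpace ComplexConjugate

namespace Literature.Analysis.FluidPDE

namespace NSSobolev

open Literature.Analysis.FunctionSpaces Literature.Analysis.FunctionSpaces.Torus NSGevrey

variable {d : Type*} [Fintype d] [DecidableEq d]

/-! ### §1 `H⁶` majorant; continuity and termwise differentiability of the `Ḣ^s` sum for `n < 12 − 2s` -/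

omit [DecidableEq d] in
/-- The punctured lattice `p`-series `∑_{k≠0} |k|^{-2t}` converges for `2t > n`. [folklore] -/
private theorem summable_ite_freqNormSq_rpow_neg_hi {t : ℝ} (ht : (Fintype.card d : ℝ) < 2 * t) :
    Summable fun k : d → ℤ => if k = 0 then (0 : ℝ) else freqNormSq k ^ (-t) := by
  classical
  have ht0 : 0 ≤ t := by
    have : (0 : ℝ) ≤ Fintype.card d := Nat.cast_nonneg _
    linarith
  rcases isEmpty_or_nonempty d with hd | hd
  · refine summable_of_ne_finset_zero (s := ∅) fun k _ => ?_
    rw [if_pos (Subsingleton.elim k 0)]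
  have hmaj := (summable_one_add_freqNormSq_rpow_neg (d := d) ht).mul_left ((2 : ℝ) ^ t)
  refine Summable.of_nonneg_of_le (fun k => ?_) (fun k => ?_) hmaj
  · split_ifs
    · exact le_rfl
    · exact Real.rpow_nonneg (freqNormSq_nonneg k) _
  · split_ifs with hk
    · exact mul_nonneg (Real.rpow_nonneg (by norm_num) _)
        (Real.rpow_nonneg (by linarith [freqNormSq_nonneg k]) _)
    · have hm : 1 ≤ freqNormSq k := one_le_freqNormSq_of_ne_zero hk
      have hm0 : 0 < freqNormSq k := by linarith
      have h2 : (freqNormSq k)⁻¹ ≤ 2 / (1 + freqNormSq k) := by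
        rw [inv_eq_one_div, div_le_div_iff₀ hm0 (by linarith)]
        linarith
      calc freqNormSq k ^ (-t) = (freqNormSq k)⁻¹ ^ t := by
            rw [Real.rpow_neg hm0.le, Real.inv_rpow hm0.le]
        _ ≤ (2 / (1 + freqNormSq k)) ^ t := Real.rpow_le_rpow (inv_nonneg.2 hm0.le) h2 ht0
        _ = 2 ^ t * (1 + freqNormSq k) ^ (-t) := by
            rw [Real.div_rpow (by norm_num) (by linarith), Real.rpow_neg (by linarith),
              div_eq_mul_inv]

/-- **Uniform `H⁶` decay on a compact window**: for a field `g` jointly smooth on `[a, b] × T^n`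
there is `W` with `|k|^{12} ‖ĝ(τ, k)‖² ≤ W` for all `τ ∈ [a, b]` and all `k` (Parseval for
`Δ³g(τ)` and the uniform bound of `∫‖Δ(Δ²g)‖²` on the window).
[cite: RobinsonSadowskiSilva2012, §IV (regularity used for the energy method)] -/
theorem exists_forall_pow_six_mul_norm_sq_le {a b : ℝ} (hab : a < b)
    {g : ℝ → UnitAddTorus d → EuclideanSpace ℝ d} (hg : Torus.IsSmoothSpaceTimeOn (Icc a b) g) :
    ∃ W : ℝ, 0 ≤ W ∧ ∀ τ ∈ Icc a b, ∀ k : d → ℤ,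
      freqNormSq k ^ 6 * ‖mFourierCoeff (EuclideanSpace.complexify ∘ g τ) k‖ ^ 2 ≤ W := by
  have hU : UniqueDiffOn ℝ (Icc a b) := uniqueDiffOn_Icc hab
  have hL : Torus.IsSmoothSpaceTimeOn (Icc a b) (fun τ => Torus.laplacian (g τ)) := hg.laplacian hU
  have hLL : Torus.IsSmoothSpaceTimeOn (Icc a b)
      (fun τ => Torus.laplacian (Torus.laplacian (g τ))) := hL.laplacian hU
  obtain ⟨D, hD0, hD⟩ := hLL.exists_forall_integral_norm_laplacian_sq_le hab
  refine ⟨D / (4 * Real.pi ^ 2) ^ 6, by positivity, fun τ hτ k => ?_⟩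
  have hgt : IsSmooth (g τ) := hg.isSmooth_slice hτ
  have hsum := hasSum_freqNormSq_sq_mul_norm_sq_mFourierCoeff hgt.laplacian.laplacian
  have hle : (4 * Real.pi ^ 2 * freqNormSq k) ^ 2 *
      ‖mFourierCoeff (EuclideanSpace.complexify ∘
        Torus.laplacian (Torus.laplacian (g τ))) k‖ ^ 2 ≤ D :=
    (le_hasSum hsum k fun j _ => mul_nonneg (sq_nonneg _) (sq_nonneg _)).trans (hD τ hτ)
  have hx0 : (0 : ℝ) ≤ 4 * Real.pi ^ 2 * freqNormSq k := by
    have := freqNormSq_nonneg k; positivity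
  rw [mFourierCoeff_complexify_laplacian hgt.laplacian, mFourierCoeff_complexify_laplacian hgt,
    smul_neg, neg_neg, norm_smul, norm_smul, Complex.norm_real, Real.norm_eq_abs,
    abs_of_nonneg hx0] at hle
  rw [le_div_iff₀ (by positivity)]
  calc freqNormSq k ^ 6 * ‖mFourierCoeff (EuclideanSpace.complexify ∘ g τ) k‖ ^ 2 *
        (4 * Real.pi ^ 2) ^ 6
      = (4 * Real.pi ^ 2 * freqNormSq k) ^ 2 * (4 * Real.pi ^ 2 * freqNormSq k *
          (4 * Real.pi ^ 2 * freqNormSq k *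
            ‖mFourierCoeff (EuclideanSpace.complexify ∘ g τ) k‖)) ^ 2 := by ring
    _ ≤ D := hle

/-- **Termwise differentiation of the `Ḣ^s` sum for `n < 12 − 2s`** (as
`NSSobolev.hasDerivAt_tsum_rpow_mul_norm_sq`, with the `H⁶` majorant): for `u` jointly smooth
on `[a, b] × T^n`, `s > 0`, at every interior `t`,
`d/dτ ∑|k|^{2s}‖û(τ,k)‖² = ∑|k|^{2s} 2Re⟪𝓕(∂ₜu(t))(k), û(t,k)⟫`.
[cite: RobinsonSadowskiSilva2012, §IV (energy method in `Ḣ^s`)] -/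
theorem hasDerivAt_tsum_rpow_mul_norm_sq_of_lt_six {a b : ℝ} (hab : a < b)
    {u : ℝ → UnitAddTorus d → EuclideanSpace ℝ d} (hu : Torus.IsSmoothSpaceTimeOn (Icc a b) u)
    {s : ℝ} (hs : 0 < s) (hsd : (Fintype.card d : ℝ) < 2 * (6 - s)) {t : ℝ} (ht : t ∈ Ioo a b) :
    HasDerivAt (fun τ => ∑' k : d → ℤ,
        freqNormSq k ^ s * ‖mFourierCoeff (EuclideanSpace.complexify ∘ u τ) k‖ ^ 2)
      (∑' k : d → ℤ, freqNormSq k ^ s *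
        (2 * (inner ℂ (mFourierCoeff (EuclideanSpace.complexify ∘ timeDerivWithin (Icc a b) u t) k)
          (mFourierCoeff (EuclideanSpace.complexify ∘ u t) k)).re)) t := by
  classical
  have hU : UniqueDiffOn ℝ (Icc a b) := uniqueDiffOn_Icc hab
  have hw : Torus.IsSmoothSpaceTimeOn (Icc a b) (timeDerivWithin (Icc a b) u) := hu.timeDerivWithin hU
  obtain ⟨W₁, hW₁0, hW₁⟩ := exists_forall_pow_six_mul_norm_sq_le hab hu
  obtain ⟨W₂, hW₂0, hW₂⟩ := exists_forall_pow_six_mul_norm_sq_le hab hw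
  set M : (d → ℤ) → ℝ := fun k =>
    (W₁ + W₂) * (if k = 0 then (0 : ℝ) else freqNormSq k ^ (-(6 - s))) with hM
  have hMs : Summable M := (summable_ite_freqNormSq_rpow_neg_hi (d := d) (by linarith)).mul_left _
  have hderiv : ∀ (k : d → ℤ) (τ : ℝ), τ ∈ Ioo a b →
      HasDerivAt (fun τ => freqNormSq k ^ s * ‖mFourierCoeff (EuclideanSpace.complexify ∘ u τ) k‖ ^ 2)
        (freqNormSq k ^ s * (2 * (inner ℂ
          (mFourierCoeff (EuclideanSpace.complexify ∘ timeDerivWithin (Icc a b) u τ) k)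
          (mFourierCoeff (EuclideanSpace.complexify ∘ u τ) k)).re)) τ := fun k τ hτ =>
    ((hasDerivWithinAt_norm_sq_mFourierCoeff hu (convex_Icc a b) hU
      (Ioo_subset_Icc_self hτ) k).hasDerivAt (Icc_mem_nhds hτ.1 hτ.2)).const_mul _
  have hbound : ∀ (k : d → ℤ) (τ : ℝ), τ ∈ Ioo a b →
      ‖freqNormSq k ^ s * (2 * (inner ℂ
          (mFourierCoeff (EuclideanSpace.complexify ∘ timeDerivWithin (Icc a b) u τ) k)
          (mFourierCoeff (EuclideanSpace.complexify ∘ u τ) k)).re)‖ ≤ M k := by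
    intro k τ hτ
    have hτ' : τ ∈ Icc a b := Ioo_subset_Icc_self hτ
    set α : EuclideanSpace ℂ d :=
      mFourierCoeff (EuclideanSpace.complexify ∘ timeDerivWithin (Icc a b) u τ) k with hα
    set β : EuclideanSpace ℂ d := mFourierCoeff (EuclideanSpace.complexify ∘ u τ) k with hβ
    rw [Real.norm_eq_abs, abs_mul, abs_of_nonneg (Real.rpow_nonneg (freqNormSq_nonneg k) s)]
    have h1 : |2 * (inner ℂ α β).re| ≤ ‖α‖ ^ 2 + ‖β‖ ^ 2 := by
      rw [abs_mul, abs_two]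
      have := (Complex.abs_re_le_norm (inner ℂ α β)).trans (norm_inner_le_norm α β)
      nlinarith [sq_nonneg (‖α‖ - ‖β‖), norm_nonneg α, norm_nonneg β,
        abs_nonneg (inner ℂ α β).re]
    by_cases hk : k = 0
    · have hx : freqNormSq k = 0 := by rw [hk, freqNormSq_zero]
      have hM0 : M k = 0 := by simp only [hM, if_pos hk, mul_zero]
      rw [hx, Real.zero_rpow hs.ne', zero_mul, hM0]
    · have hx : 1 ≤ freqNormSq k := one_le_freqNormSq_of_ne_zero hk
      have hx0 : 0 < freqNormSq k := by linarith
      have e : freqNormSq k ^ s = freqNormSq k ^ (-(6 - s)) * freqNormSq k ^ 6 := by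
        rw [← Real.rpow_natCast (freqNormSq k) 6, ← Real.rpow_add hx0]
        congr 1
        push_cast
        ring
      have hMk : M k = freqNormSq k ^ (-(6 - s)) * (W₂ + W₁) := by
        simp only [hM, if_neg hk]
        ring
      calc freqNormSq k ^ s * |2 * (inner ℂ α β).re|
          ≤ freqNormSq k ^ s * (‖α‖ ^ 2 + ‖β‖ ^ 2) :=
            mul_le_mul_of_nonneg_left h1 (Real.rpow_nonneg (freqNormSq_nonneg k) s)
        _ = freqNormSq k ^ (-(6 - s)) *
              (freqNormSq k ^ 6 * ‖α‖ ^ 2 + freqNormSq k ^ 6 * ‖β‖ ^ 2) := by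
            rw [e]; ring
        _ ≤ freqNormSq k ^ (-(6 - s)) * (W₂ + W₁) :=
            mul_le_mul_of_nonneg_left (add_le_add (hW₂ τ hτ' k) (hW₁ τ hτ' k))
              (Real.rpow_nonneg (freqNormSq_nonneg k) _)
        _ = M k := hMk.symm
  have hsum0 : Summable fun k : d → ℤ =>
      freqNormSq k ^ s * ‖mFourierCoeff (EuclideanSpace.complexify ∘ u t) k‖ ^ 2 :=
    (hu.isSmooth_slice (Ioo_subset_Icc_self ht)).summable_freqNormSq_rpow_mul_norm_sq hs.le
  exact hasDerivAt_tsum_of_isPreconnected hMs isOpen_Ioo isPreconnected_Ioo hderiv hbound ht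
    hsum0 ht

/-- Continuity in time of the full `Ḣ^s` sum on a closed window for `0 < s`, `n < 12 − 2s`
(the `H⁶` majorant). [cite: RobinsonSadowskiSilva2012, §IV (energy method in `Ḣ^s`)] -/
theorem continuousOn_tsum_rpow_mul_norm_sq_of_lt_six {a b : ℝ} (hab : a < b)
    {u : ℝ → UnitAddTorus d → EuclideanSpace ℝ d} (hu : Torus.IsSmoothSpaceTimeOn (Icc a b) u)
    {s : ℝ} (hs : 0 < s) (hsd : (Fintype.card d : ℝ) < 2 * (6 - s)) :
    ContinuousOn (fun τ => ∑' k : d → ℤ,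
      freqNormSq k ^ s * ‖mFourierCoeff (EuclideanSpace.complexify ∘ u τ) k‖ ^ 2) (Icc a b) := by
  classical
  have hU : UniqueDiffOn ℝ (Icc a b) := uniqueDiffOn_Icc hab
  obtain ⟨W₁, hW₁0, hW₁⟩ := exists_forall_pow_six_mul_norm_sq_le hab hu
  set M : (d → ℤ) → ℝ := fun k =>
    W₁ * (if k = 0 then (0 : ℝ) else freqNormSq k ^ (-(6 - s))) with hM
  have hMs : Summable M := (summable_ite_freqNormSq_rpow_neg_hi (d := d) (by linarith)).mul_left _
  refine continuousOn_tsum (fun k => ?_) hMs (fun k τ hτ => ?_)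
  · exact continuousOn_const.mul (continuousOn_norm_sq_mFourierCoeff hu (convex_Icc a b) hU k)
  · rw [Real.norm_eq_abs, abs_of_nonneg (mul_nonneg (Real.rpow_nonneg (freqNormSq_nonneg k) s)
      (sq_nonneg _))]
    by_cases hk : k = 0
    · have hx : freqNormSq k = 0 := by rw [hk, freqNormSq_zero]
      have hM0 : M k = 0 := by simp only [hM, if_pos hk, mul_zero]
      rw [hx, Real.zero_rpow hs.ne', zero_mul, hM0]
    · have hx : 1 ≤ freqNormSq k := one_le_freqNormSq_of_ne_zero hk
      have hx0 : 0 < freqNormSq k := by linarith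
      have e : freqNormSq k ^ s = freqNormSq k ^ (-(6 - s)) * freqNormSq k ^ 6 := by
        rw [← Real.rpow_natCast (freqNormSq k) 6, ← Real.rpow_add hx0]
        congr 1
        push_cast
        ring
      have hMk : M k = freqNormSq k ^ (-(6 - s)) * W₁ := by
        simp only [hM, if_neg hk]
        ring
      calc freqNormSq k ^ s * ‖mFourierCoeff (EuclideanSpace.complexify ∘ u τ) k‖ ^ 2
          = freqNormSq k ^ (-(6 - s)) *
              (freqNormSq k ^ 6 * ‖mFourierCoeff (EuclideanSpace.complexify ∘ u τ) k‖ ^ 2) := by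
            rw [e]; ring
        _ ≤ freqNormSq k ^ (-(6 - s)) * W₁ :=
            mul_le_mul_of_nonneg_left (hW₁ τ hτ k) (Real.rpow_nonneg (freqNormSq_nonneg k) _)
        _ = M k := hMk.symm

/-- `‖𝓕(complexify ∘ Δⁿg)(k)‖ = (4π²|k|²)ⁿ ‖ĝ(k)‖` for a smooth field. [folklore] -/
private theorem norm_mFourierCoeff_complexify_laplacian_iterate
    {g : UnitAddTorus d → EuclideanSpace ℝ d} (hg : IsSmooth g) :
    ∀ (n : ℕ) (k : d → ℤ), ‖mFourierCoeff (EuclideanSpace.complexify ∘ Torus.laplacian^[n] g) k‖ =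
      (4 * Real.pi ^ 2 * freqNormSq k) ^ n * ‖mFourierCoeff (EuclideanSpace.complexify ∘ g) k‖
  | 0, k => by simp
  | n + 1, k => by
    rw [Function.iterate_succ_apply', mFourierCoeff_complexify_laplacian (isSmooth_laplacian_iterate hg n),
      norm_neg, norm_smul, Complex.norm_real, Real.norm_of_nonneg
        (by have := freqNormSq_nonneg k; positivity),
      norm_mFourierCoeff_complexify_laplacian_iterate hg n k, pow_succ]
    ring

/-- **Uniform `H^{2n+2}` decay on a compact window**: for a field `g` jointly smooth on
`[a, b] × T^n₀` and every `n : ℕ` there is `W` with `|k|^{4n+4} ‖ĝ(τ, k)‖² ≤ W` for all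
`τ ∈ [a, b]`, `k` (Parseval for `Δ(Δⁿ g(τ))` and the uniform bound of `∫‖Δ(Δⁿg)‖²` on the window).
[cite: RobinsonSadowskiSilva2012, §IV (regularity used for the energy method)] -/
theorem exists_forall_pow_mul_norm_sq_le (n : ℕ) {a b : ℝ} (hab : a < b)
    {g : ℝ → UnitAddTorus d → EuclideanSpace ℝ d} (hg : Torus.IsSmoothSpaceTimeOn (Icc a b) g) :
    ∃ W : ℝ, 0 ≤ W ∧ ∀ τ ∈ Icc a b, ∀ k : d → ℤ,
      freqNormSq k ^ (2 * n + 2) * ‖mFourierCoeff (EuclideanSpace.complexify ∘ g τ) k‖ ^ 2 ≤ W := by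
  have hU : UniqueDiffOn ℝ (Icc a b) := uniqueDiffOn_Icc hab
  have hL : Torus.IsSmoothSpaceTimeOn (Icc a b) (fun τ => Torus.laplacian^[n] (g τ)) :=
    hg.laplacian_iterate hU n
  obtain ⟨D, hD0, hD⟩ := hL.exists_forall_integral_norm_laplacian_sq_le hab
  refine ⟨D / (4 * Real.pi ^ 2) ^ (2 * n + 2), by positivity, fun τ hτ k => ?_⟩
  have hgt : IsSmooth (g τ) := hg.isSmooth_slice hτ
  have hsum := hasSum_freqNormSq_sq_mul_norm_sq_mFourierCoeff (isSmooth_laplacian_iterate hgt n)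
  have hle : (4 * Real.pi ^ 2 * freqNormSq k) ^ 2 *
      ‖mFourierCoeff (EuclideanSpace.complexify ∘ Torus.laplacian^[n] (g τ)) k‖ ^ 2 ≤ D :=
    (le_hasSum hsum k fun j _ => mul_nonneg (sq_nonneg _) (sq_nonneg _)).trans (hD τ hτ)
  rw [norm_mFourierCoeff_complexify_laplacian_iterate hgt n k] at hle
  rw [le_div_iff₀ (by positivity)]
  calc freqNormSq k ^ (2 * n + 2) * ‖mFourierCoeff (EuclideanSpace.complexify ∘ g τ) k‖ ^ 2 *
        (4 * Real.pi ^ 2) ^ (2 * n + 2)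
      = (4 * Real.pi ^ 2 * freqNormSq k) ^ 2 * ((4 * Real.pi ^ 2 * freqNormSq k) ^ n *
          ‖mFourierCoeff (EuclideanSpace.complexify ∘ g τ) k‖) ^ 2 := by ring
    _ ≤ D := hle

/-- **Termwise differentiation of the `Ḣ^s` sum for `n₀ < 4n + 4 − 2s`** (any `n : ℕ`; the
`H^{2n+2}` majorant): for `u` jointly smooth on `[a, b] × T^{n₀}`, `s > 0`, at every interior `t`,
`d/dτ ∑|k|^{2s}‖û(τ,k)‖² = ∑|k|^{2s} 2Re⟪𝓕(∂ₜu(t))(k), û(t,k)⟫`.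
[cite: RobinsonSadowskiSilva2012, §IV (energy method in `Ḣ^s`)] -/
theorem hasDerivAt_tsum_rpow_mul_norm_sq_of_lt (n : ℕ) {a b : ℝ} (hab : a < b)
    {u : ℝ → UnitAddTorus d → EuclideanSpace ℝ d} (hu : Torus.IsSmoothSpaceTimeOn (Icc a b) u)
    {s : ℝ} (hs : 0 < s) (hsd : (Fintype.card d : ℝ) < 2 * (2 * n + 2 - s)) {t : ℝ}
    (ht : t ∈ Ioo a b) :
    HasDerivAt (fun τ => ∑' k : d → ℤ,
        freqNormSq k ^ s * ‖mFourierCoeff (EuclideanSpace.complexify ∘ u τ) k‖ ^ 2)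
      (∑' k : d → ℤ, freqNormSq k ^ s *
        (2 * (inner ℂ (mFourierCoeff (EuclideanSpace.complexify ∘ timeDerivWithin (Icc a b) u t) k)
          (mFourierCoeff (EuclideanSpace.complexify ∘ u t) k)).re)) t := by
  classical
  have hU : UniqueDiffOn ℝ (Icc a b) := uniqueDiffOn_Icc hab
  have hw : Torus.IsSmoothSpaceTimeOn (Icc a b) (timeDerivWithin (Icc a b) u) := hu.timeDerivWithin hU
  obtain ⟨W₁, hW₁0, hW₁⟩ := exists_forall_pow_mul_norm_sq_le n hab hu
  obtain ⟨W₂, hW₂0, hW₂⟩ := exists_forall_pow_mul_norm_sq_le n hab hw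
  set N : ℕ := 2 * n + 2 with hN
  have hNr : ((N : ℕ) : ℝ) = 2 * n + 2 := by rw [hN]; push_cast; ring
  set M : (d → ℤ) → ℝ := fun k =>
    (W₁ + W₂) * (if k = 0 then (0 : ℝ) else freqNormSq k ^ (-((N : ℝ) - s))) with hM
  have hMs : Summable M :=
    (summable_ite_freqNormSq_rpow_neg_hi (d := d) (by rw [hNr]; linarith)).mul_left _
  have hderiv : ∀ (k : d → ℤ) (τ : ℝ), τ ∈ Ioo a b →
      HasDerivAt (fun τ => freqNormSq k ^ s * ‖mFourierCoeff (EuclideanSpace.complexify ∘ u τ) k‖ ^ 2)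
        (freqNormSq k ^ s * (2 * (inner ℂ
          (mFourierCoeff (EuclideanSpace.complexify ∘ timeDerivWithin (Icc a b) u τ) k)
          (mFourierCoeff (EuclideanSpace.complexify ∘ u τ) k)).re)) τ := fun k τ hτ =>
    ((hasDerivWithinAt_norm_sq_mFourierCoeff hu (convex_Icc a b) hU
      (Ioo_subset_Icc_self hτ) k).hasDerivAt (Icc_mem_nhds hτ.1 hτ.2)).const_mul _
  have hbound : ∀ (k : d → ℤ) (τ : ℝ), τ ∈ Ioo a b →
      ‖freqNormSq k ^ s * (2 * (inner ℂ
          (mFourierCoeff (EuclideanSpace.complexify ∘ timeDerivWithin (Icc a b) u τ) k)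
          (mFourierCoeff (EuclideanSpace.complexify ∘ u τ) k)).re)‖ ≤ M k := by
    intro k τ hτ
    have hτ' : τ ∈ Icc a b := Ioo_subset_Icc_self hτ
    set α : EuclideanSpace ℂ d :=
      mFourierCoeff (EuclideanSpace.complexify ∘ timeDerivWithin (Icc a b) u τ) k with hα
    set β : EuclideanSpace ℂ d := mFourierCoeff (EuclideanSpace.complexify ∘ u τ) k with hβ
    rw [Real.norm_eq_abs, abs_mul, abs_of_nonneg (Real.rpow_nonneg (freqNormSq_nonneg k) s)]
    have h1 : |2 * (inner ℂ α β).re| ≤ ‖α‖ ^ 2 + ‖β‖ ^ 2 := by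
      rw [abs_mul, abs_two]
      have := (Complex.abs_re_le_norm (inner ℂ α β)).trans (norm_inner_le_norm α β)
      nlinarith [sq_nonneg (‖α‖ - ‖β‖), norm_nonneg α, norm_nonneg β,
        abs_nonneg (inner ℂ α β).re]
    by_cases hk : k = 0
    · have hx : freqNormSq k = 0 := by rw [hk, freqNormSq_zero]
      have hM0 : M k = 0 := by simp only [hM, if_pos hk, mul_zero]
      rw [hx, Real.zero_rpow hs.ne', zero_mul, hM0]
    · have hx : 1 ≤ freqNormSq k := one_le_freqNormSq_of_ne_zero hk
      have hx0 : 0 < freqNormSq k := by linarith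
      have e : freqNormSq k ^ s = freqNormSq k ^ (-((N : ℝ) - s)) * freqNormSq k ^ N := by
        rw [← Real.rpow_natCast (freqNormSq k) N, ← Real.rpow_add hx0]
        congr 1
        ring
      have hMk : M k = freqNormSq k ^ (-((N : ℝ) - s)) * (W₂ + W₁) := by
        simp only [hM, if_neg hk]
        ring
      calc freqNormSq k ^ s * |2 * (inner ℂ α β).re|
          ≤ freqNormSq k ^ s * (‖α‖ ^ 2 + ‖β‖ ^ 2) :=
            mul_le_mul_of_nonneg_left h1 (Real.rpow_nonneg (freqNormSq_nonneg k) s)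
        _ = freqNormSq k ^ (-((N : ℝ) - s)) *
              (freqNormSq k ^ N * ‖α‖ ^ 2 + freqNormSq k ^ N * ‖β‖ ^ 2) := by
            rw [e]; ring
        _ ≤ freqNormSq k ^ (-((N : ℝ) - s)) * (W₂ + W₁) :=
            mul_le_mul_of_nonneg_left (add_le_add (hW₂ τ hτ' k) (hW₁ τ hτ' k))
              (Real.rpow_nonneg (freqNormSq_nonneg k) _)
        _ = M k := hMk.symm
  have hsum0 : Summable fun k : d → ℤ =>
      freqNormSq k ^ s * ‖mFourierCoeff (EuclideanSpace.complexify ∘ u t) k‖ ^ 2 :=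
    (hu.isSmooth_slice (Ioo_subset_Icc_self ht)).summable_freqNormSq_rpow_mul_norm_sq hs.le
  exact hasDerivAt_tsum_of_isPreconnected hMs isOpen_Ioo isPreconnected_Ioo hderiv hbound ht
    hsum0 ht

/-- Continuity in time of the full `Ḣ^s` sum on a closed window for `0 < s`, `n₀ < 4n + 4 − 2s`
(any `n : ℕ`). [cite: RobinsonSadowskiSilva2012, §IV (energy method in `Ḣ^s`)] -/
theorem continuousOn_tsum_rpow_mul_norm_sq_of_lt (n : ℕ) {a b : ℝ} (hab : a < b)
    {u : ℝ → UnitAddTorus d → EuclideanSpace ℝ d} (hu : Torus.IsSmoothSpaceTimeOn (Icc a b) u)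
    {s : ℝ} (hs : 0 < s) (hsd : (Fintype.card d : ℝ) < 2 * (2 * n + 2 - s)) :
    ContinuousOn (fun τ => ∑' k : d → ℤ,
      freqNormSq k ^ s * ‖mFourierCoeff (EuclideanSpace.complexify ∘ u τ) k‖ ^ 2) (Icc a b) := by
  classical
  have hU : UniqueDiffOn ℝ (Icc a b) := uniqueDiffOn_Icc hab
  obtain ⟨W₁, hW₁0, hW₁⟩ := exists_forall_pow_mul_norm_sq_le n hab hu
  set N : ℕ := 2 * n + 2 with hN
  have hNr : ((N : ℕ) : ℝ) = 2 * n + 2 := by rw [hN]; push_cast; ring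
  set M : (d → ℤ) → ℝ := fun k =>
    W₁ * (if k = 0 then (0 : ℝ) else freqNormSq k ^ (-((N : ℝ) - s))) with hM
  have hMs : Summable M :=
    (summable_ite_freqNormSq_rpow_neg_hi (d := d) (by rw [hNr]; linarith)).mul_left _
  refine continuousOn_tsum (fun k => ?_) hMs (fun k τ hτ => ?_)
  · exact continuousOn_const.mul (continuousOn_norm_sq_mFourierCoeff hu (convex_Icc a b) hU k)
  · rw [Real.norm_eq_abs, abs_of_nonneg (mul_nonneg (Real.rpow_nonneg (freqNormSq_nonneg k) s)
      (sq_nonneg _))]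
    by_cases hk : k = 0
    · have hx : freqNormSq k = 0 := by rw [hk, freqNormSq_zero]
      have hM0 : M k = 0 := by simp only [hM, if_pos hk, mul_zero]
      rw [hx, Real.zero_rpow hs.ne', zero_mul, hM0]
    · have hx : 1 ≤ freqNormSq k := one_le_freqNormSq_of_ne_zero hk
      have hx0 : 0 < freqNormSq k := by linarith
      have e : freqNormSq k ^ s = freqNormSq k ^ (-((N : ℝ) - s)) * freqNormSq k ^ N := by
        rw [← Real.rpow_natCast (freqNormSq k) N, ← Real.rpow_add hx0]
        congr 1
        ring
      have hMk : M k = freqNormSq k ^ (-((N : ℝ) - s)) * W₁ := by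
        simp only [hM, if_neg hk]
        ring
      calc freqNormSq k ^ s * ‖mFourierCoeff (EuclideanSpace.complexify ∘ u τ) k‖ ^ 2
          = freqNormSq k ^ (-((N : ℝ) - s)) *
              (freqNormSq k ^ N * ‖mFourierCoeff (EuclideanSpace.complexify ∘ u τ) k‖ ^ 2) := by
            rw [e]; ring
        _ ≤ freqNormSq k ^ (-((N : ℝ) - s)) * W₁ :=
            mul_le_mul_of_nonneg_left (hW₁ τ hτ k) (Real.rpow_nonneg (freqNormSq_nonneg k) _)
        _ = M k := hMk.symm

/-! ### §2 The `Ḣ^s` energy inequality for `s > 5/2` -/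

omit [DecidableEq d] in
/-- The zero force has zero Fourier coefficients. [folklore] -/
private theorem mFourierCoeff_complexify_zero_force' (t : ℝ) (k : d → ℤ) :
    mFourierCoeff (EuclideanSpace.complexify ∘
      (0 : ℝ → UnitAddTorus d → EuclideanSpace ℝ d) t) k = 0 := by
  have h : (EuclideanSpace.complexify ∘ (0 : ℝ → UnitAddTorus d → EuclideanSpace ℝ d) t) =
      (0 : UnitAddTorus d → EuclideanSpace ℂ d) := by
    funext x
    simp
  rw [h, mFourierCoeff_eq_integral_volume]
  simp

/-- **The `Ḣ^s` energy inequality above `s = 5/2`** (Robinson–Sadowski–Silva 2012, Lemma 2.2 /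
§VI in differential form; mechanism of §IV "now using (3.6) and (3.10)" with the interpolation
pair `(0, s)`): for `card d = 3` and every `s > 5/2` there is `K = K(s) ≥ 0` such that for every
`ν > 0`, every classical solution `(u, p)` of `Torus.IsClassicalNSSolutionOn (Icc a b) ν 0 u p`
with mean-zero slices and every interior `t`, `X(τ) = ∑|k|^{2s}‖û(τ,k)‖²` is differentiable at
`t` and
`X'(t) ≤ −8π²ν ∑|k|^{2s+2}‖û(t,k)‖² + K (∫‖u(t)‖²)^{(2s−5)/(4s)} X(t)^{(4s+5)/(4s)}`
(`|2∑|k|^{2s}Re⟪𝓕((u·∇)u),û⟫| ≤ 2C₆ X ‖u‖_{F_1}`, (3.6), and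
`‖u‖_{F_1} ≤ C_I ‖u‖₂^{(2s−5)/(2s)} X^{5/(4s)}`, Lemma 3.2 at `r = 1`, levels `0 < 5/2 < s`). The
right-hand side is `ν`-free: the `Ḣ^s` lifespan for `s > 5/2` is at least
`c ‖u₀‖₂^{−(2s−5)/(2s)} ‖u₀‖_{Ḣ^s}^{−5/(2s)}` (RSS Lemma 2.2).
[cite: RobinsonSadowskiSilva2012, Lemma 2.2 with §III (3.6), (3.10)] -/
theorem hsSeminorm_sq_deriv_le_of_gt_five_halves' (hd : Fintype.card d = 3) {s : ℝ}
    (hs : 5 / 2 < s) :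
    ∃ K : ℝ, 0 ≤ K ∧ ∀ {ν a b : ℝ}, 0 < ν → a < b →
      ∀ {u : ℝ → UnitAddTorus d → EuclideanSpace ℝ d} {p : ℝ → UnitAddTorus d → ℝ},
      Torus.IsClassicalNSSolutionOn (Icc a b) ν 0 u p → (∀ t ∈ Icc a b, HasZeroMean (u t)) →
      ∀ t ∈ Ioo a b, ∃ D : ℝ,
        HasDerivAt (fun τ => ∑' k : d → ℤ,
          freqNormSq k ^ s * ‖mFourierCoeff (EuclideanSpace.complexify ∘ u τ) k‖ ^ 2) D t ∧
        D ≤ -(8 * Real.pi ^ 2 * ν) *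
              (∑' k : d → ℤ, freqNormSq k ^ (s + 1) *
                ‖mFourierCoeff (EuclideanSpace.complexify ∘ u t) k‖ ^ 2) +
            K * (∫ x, ‖u t x‖ ^ 2) ^ ((2 * s - 5) / (4 * s)) *
              (∑' k : d → ℤ, freqNormSq k ^ s *
                ‖mFourierCoeff (EuclideanSpace.complexify ∘ u t) k‖ ^ 2) ^
                  ((4 * s + 5) / (4 * s)) := by
  classical
  have hn : (Fintype.card d : ℝ) = 3 := by rw [hd]; norm_num
  have hs0 : (0 : ℝ) < s := by linarith
  obtain ⟨CI, hCI0, hCI⟩ := exists_tsum_rpow_mul_norm_le_interpolation (d := d) (r := 1) (s₁ := 0)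
    (s₂ := s) (by rw [hn]; linarith) (by rw [hn]; linarith)
  set CT : ℝ := 4 * Real.pi * (Fintype.card d : ℝ) ^ 2 * (2 : ℝ) ^ s with hCT
  have hCT0 : 0 ≤ CT := by rw [hCT]; positivity
  set C₆ : ℝ := 4 * Real.pi * (Fintype.card d : ℝ) * (s * (2 : ℝ) ^ s) with hC₆
  have hC₆0 : 0 ≤ C₆ := by rw [hC₆]; positivity
  refine ⟨2 * C₆ * CI, by positivity, fun {ν a b} hν hab {u p} h hmean t ht => ?_⟩
  have hU : UniqueDiffOn ℝ (Icc a b) := uniqueDiffOn_Icc hab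
  have htS : t ∈ Icc a b := Ioo_subset_Icc_self ht
  have hut : IsSmooth (u t) := h.smooth_velocity.isSmooth_slice htS
  obtain ⟨n, hn'⟩ := exists_nat_gt s
  refine ⟨_, hasDerivAt_tsum_rpow_mul_norm_sq_of_lt n hab h.smooth_velocity hs0
    (by rw [hn]; linarith) ht, ?_⟩
  -- notation
  set c : (d → ℤ) → EuclideanSpace ℂ d := fun k => mFourierCoeff (EuclideanSpace.complexify ∘ u t) k
    with hc
  set w : (d → ℤ) → EuclideanSpace ℂ d :=
    fun k => mFourierCoeff (EuclideanSpace.complexify ∘ timeDerivWithin (Icc a b) u t) k with hw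
  set B : (d → ℤ) → EuclideanSpace ℂ d :=
    fun k => mFourierCoeff (EuclideanSpace.complexify ∘ Torus.convect (u t) (u t)) k with hB
  set X : ℝ := ∑' k, freqNormSq k ^ s * ‖c k‖ ^ 2 with hX
  set Z : ℝ := ∑' k, freqNormSq k ^ (s + 1) * ‖c k‖ ^ 2 with hZ
  set F : ℝ := ∑' k, ‖c k‖ with hF
  set F₁ : ℝ := ∑' k, Real.sqrt (freqNormSq k) * ‖c k‖ with hF₁
  set E : ℝ := ∫ x, ‖u t x‖ ^ 2 with hE
  have hw0 : ∀ (r : ℝ) k, 0 ≤ freqNormSq k ^ r * ‖c k‖ ^ 2 := fun r k =>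
    mul_nonneg (Real.rpow_nonneg (freqNormSq_nonneg k) _) (sq_nonneg _)
  have hsumX : Summable fun k => freqNormSq k ^ s * ‖c k‖ ^ 2 :=
    hut.summable_freqNormSq_rpow_mul_norm_sq hs0.le
  have hsumZ : Summable fun k => freqNormSq k ^ (s + 1) * ‖c k‖ ^ 2 :=
    hut.summable_freqNormSq_rpow_mul_norm_sq (by linarith)
  have hX0 : 0 ≤ X := tsum_nonneg (hw0 s)
  have hZ0 : 0 ≤ Z := tsum_nonneg (hw0 (s + 1))
  have hF0 : 0 ≤ F := tsum_nonneg fun k => norm_nonneg _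
  have hE0 : 0 ≤ E := integral_nonneg fun x => sq_nonneg _
  show ∑' k, freqNormSq k ^ s * (2 * (inner ℂ (w k) (c k)).re) ≤
    -(8 * Real.pi ^ 2 * ν) * Z +
      2 * C₆ * CI * E ^ ((2 * s - 5) / (4 * s)) * X ^ ((4 * s + 5) / (4 * s))
  -- ### the modewise energy identity
  have hid : ∀ k, (inner ℂ (w k) (c k)).re =
      -(ν * (4 * Real.pi ^ 2 * freqNormSq k)) * ‖c k‖ ^ 2 - (inner ℂ (B k) (c k)).re := by
    intro k
    have h1 := h.re_inner_mFourierCoeff_timeDerivWithin hU htS k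
    rw [mFourierCoeff_complexify_zero_force', inner_zero_left, Complex.zero_re, add_zero] at h1
    exact h1
  -- ### summability of the trilinear family
  set Rk : (d → ℤ) → ℝ := fun k => freqNormSq k ^ s * ‖c k‖ * ‖B k‖ with hR
  have hR0 : ∀ k, 0 ≤ Rk k := fun k =>
    mul_nonneg (mul_nonneg (Real.rpow_nonneg (freqNormSq_nonneg k) _) (norm_nonneg _)) (norm_nonneg _)
  have hRK : ∀ K : Finset (d → ℤ), ∑ k ∈ K, Rk k ≤ CT * F * Real.sqrt X * Real.sqrt Z := by
    intro K
    have h1 := sum_rpow_mul_norm_mul_norm_convect_le hut (h.divFree t htS) hs0.le K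
    refine h1.trans ?_
    have h2 : Real.sqrt (∑ k ∈ K, freqNormSq k ^ (s + 1) * ‖c k‖ ^ 2) ≤ Real.sqrt Z :=
      Real.sqrt_le_sqrt (sum_le_hasSum K (fun k _ => hw0 (s + 1) k) hsumZ.hasSum)
    exact mul_le_mul_of_nonneg_left h2 (mul_nonneg (mul_nonneg hCT0 hF0) (Real.sqrt_nonneg _))
  have hRs : Summable Rk := summable_of_sum_le hR0 hRK
  -- ### `‖u‖_{F_1} ≤ C_I ‖u‖₂^{(2s−5)/(2s)} ‖u‖_s^{5/(2s)}` (Lemma 3.2 at `r = 1`, levels `0, s`)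
  have hF₁le : F₁ ≤ CI * Real.sqrt E ^ ((2 * s - 5) / (2 * s)) * Real.sqrt X ^ (5 / (2 * s)) := by
    obtain ⟨-, hle⟩ := hCI (u t) (hut.memLp 2) (hmean t htS) hsumX
    have hsne : s ≠ 0 := hs0.ne'
    have e1 : (s - 1 - (Fintype.card d : ℝ) / 2) / (s - 0) = (2 * s - 5) / (2 * s) := by
      rw [hn, sub_zero, div_eq_div_iff hsne (by positivity)]
      ring
    have e2 : ((Fintype.card d : ℝ) / 2 + 1 - 0) / (s - 0) = 5 / (2 * s) := by
      rw [hn, sub_zero, sub_zero, div_eq_div_iff hsne (by positivity)]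
      ring
    rw [e1, e2] at hle
    have e3 : ∑' k, freqNormSq k ^ ((1 : ℝ) / 2) * ‖c k‖ = F₁ :=
      tsum_congr fun k => by rw [← Real.sqrt_eq_rpow]
    have e4 : ∑' k, freqNormSq k ^ (0 : ℝ) * ‖c k‖ ^ 2 = E := by
      rw [tsum_congr fun k => by rw [Real.rpow_zero, one_mul]]
      exact (hasSum_sq_norm_mFourierCoeff_complexify (hut.memLp 2)).tsum_eq
    rw [e3, e4] at hle
    exact hle
  -- ### split the derivative
  set Qk : (d → ℤ) → ℝ := fun k => freqNormSq k ^ s * (inner ℂ (B k) (c k)).re with hQ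
  have hQle : ∀ k, |Qk k| ≤ Rk k := fun k => by
    simp only [hQ, hR, abs_mul, abs_of_nonneg (Real.rpow_nonneg (freqNormSq_nonneg k) s), mul_assoc]
    exact mul_le_mul_of_nonneg_left
      ((Complex.abs_re_le_norm _).trans ((norm_inner_le_norm (B k) (c k)).trans
        (le_of_eq (mul_comm _ _))))
      (Real.rpow_nonneg (freqNormSq_nonneg k) s)
  have hQs : Summable Qk := Summable.of_norm_bounded hRs fun k => (Real.norm_eq_abs _).le.trans (hQle k)
  have hterm : ∀ k, freqNormSq k ^ s * (2 * (inner ℂ (w k) (c k)).re) =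
      -(8 * Real.pi ^ 2 * ν) * (freqNormSq k ^ (s + 1) * ‖c k‖ ^ 2) - 2 * Qk k := by
    intro k
    rw [hid k]
    simp only [hQ]
    have e : freqNormSq k ^ (s + 1) = freqNormSq k ^ s * freqNormSq k := by
      rw [Real.rpow_add' (freqNormSq_nonneg k) (by linarith : s + 1 ≠ 0), Real.rpow_one]
    rw [e]
    ring
  have hD : ∑' k, freqNormSq k ^ s * (2 * (inner ℂ (w k) (c k)).re) =
      -(8 * Real.pi ^ 2 * ν) * Z - 2 * ∑' k, Qk k := by
    rw [tsum_congr hterm, (hsumZ.mul_left _).tsum_sub (hQs.mul_left 2), tsum_mul_left,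
      tsum_mul_left]
  rw [hD]
  -- ### (3.6) and the interpolation
  have h36 : |∑' k, Qk k| ≤ C₆ * X * F₁ :=
    abs_tsum_rpow_mul_re_inner_convect_le hut (h.divFree t htS) (by linarith : (1 : ℝ) ≤ s)
  have hx0 : 0 ≤ Real.sqrt X := Real.sqrt_nonneg _
  have he0 : 0 ≤ Real.sqrt E := Real.sqrt_nonneg _
  have hsE : Real.sqrt E ^ ((2 * s - 5) / (2 * s)) = E ^ ((2 * s - 5) / (4 * s)) := by
    rw [Real.sqrt_eq_rpow, ← Real.rpow_mul hE0]; congr 1; ring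
  have hsX : X * Real.sqrt X ^ (5 / (2 * s)) = X ^ ((4 * s + 5) / (4 * s)) := by
    rw [Real.sqrt_eq_rpow, ← Real.rpow_mul hX0,
      show (4 * s + 5) / (4 * s) = 1 + 1 / 2 * (5 / (2 * s)) by field_simp; ring,
      Real.rpow_add' hX0 (by positivity), Real.rpow_one]
  have hprod : X * F₁ ≤ CI * E ^ ((2 * s - 5) / (4 * s)) * X ^ ((4 * s + 5) / (4 * s)) := by
    rw [← hsE, ← hsX]
    calc X * F₁ ≤ X * (CI * Real.sqrt E ^ ((2 * s - 5) / (2 * s)) * Real.sqrt X ^ (5 / (2 * s))) :=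
          mul_le_mul_of_nonneg_left hF₁le hX0
      _ = CI * Real.sqrt E ^ ((2 * s - 5) / (2 * s)) * (X * Real.sqrt X ^ (5 / (2 * s))) := by
          ring
  have hfin : -(2 : ℝ) * ∑' k, Qk k ≤
      2 * C₆ * CI * E ^ ((2 * s - 5) / (4 * s)) * X ^ ((4 * s + 5) / (4 * s)) := by
    calc -(2 : ℝ) * ∑' k, Qk k ≤ 2 * |∑' k, Qk k| := by linarith [neg_abs_le (∑' k, Qk k)]
      _ ≤ 2 * (C₆ * X * F₁) := by linarith [h36]
      _ = 2 * C₆ * (X * F₁) := by ring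
      _ ≤ 2 * C₆ * (CI * E ^ ((2 * s - 5) / (4 * s)) * X ^ ((4 * s + 5) / (4 * s))) :=
          mul_le_mul_of_nonneg_left hprod (by positivity)
      _ = 2 * C₆ * CI * E ^ ((2 * s - 5) / (4 * s)) * X ^ ((4 * s + 5) / (4 * s)) := by ring
  linarith [hfin]

/-! ### §3 Lifespan and blow-up rate above `s = 5/2` (RSS Lemma 2.2, (2.3)) -/

omit [Fintype d] [DecidableEq d] in
/-- Comparison for `X' ≤ κ X^β` (`β > 1`), regularised: for `δ > 0` and `t ∈ [a, b]`,
`(X(a)+δ)^{1−β} ≤ (X(t)+δ)^{1−β} + (β−1)κ(t−a)` (Robinson–Sadowski–Silva (4.1)). [folklore] -/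
private theorem rpow_add_le_of_deriv_le_hi {X X' : ℝ → ℝ} {a b κ β : ℝ} (hab : a < b) (hκ : 0 ≤ κ)
    (hβ : 1 < β) (hX0 : ∀ t ∈ Icc a b, 0 ≤ X t) (hXc : ContinuousOn X (Icc a b))
    (hXd : ∀ t ∈ Ioo a b, HasDerivAt X (X' t) t) (hX' : ∀ t ∈ Ioo a b, X' t ≤ κ * X t ^ β)
    {δ : ℝ} (hδ : 0 < δ) {t : ℝ} (ht : t ∈ Icc a b) :
    (X a + δ) ^ (1 - β) ≤ (X t + δ) ^ (1 - β) + (β - 1) * κ * (t - a) := by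
  set φ : ℝ → ℝ := fun τ => (X τ + δ) ^ (1 - β) + (β - 1) * κ * τ with hφ
  have hpos : ∀ τ ∈ Icc a b, 0 < X τ + δ := fun τ hτ => by linarith [hX0 τ hτ]
  have hφc : ContinuousOn φ (Icc a b) :=
    ((hXc.add continuousOn_const).rpow_const fun τ hτ => Or.inl (hpos τ hτ).ne').add
      (continuousOn_const.mul continuousOn_id)
  have hφd : ∀ τ ∈ Ioo a b, HasDerivAt φ
      (X' τ * (1 - β) * (X τ + δ) ^ (1 - β - 1) + (β - 1) * κ * 1) τ := fun τ hτ =>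
    (((hXd τ hτ).add_const δ).rpow_const (Or.inl (hpos τ (Ioo_subset_Icc_self hτ)).ne')).add
      ((hasDerivAt_id τ).const_mul ((β - 1) * κ))
  have hφ' : ∀ τ ∈ Ioo a b, 0 ≤ X' τ * (1 - β) * (X τ + δ) ^ (1 - β - 1) + (β - 1) * κ * 1 := by
    intro τ hτ
    have hτ' := Ioo_subset_Icc_self hτ
    have hXτ := hX0 τ hτ'
    have hp := hpos τ hτ'
    rw [show (1 : ℝ) - β - 1 = -β by ring]
    have h1 : X' τ * (X τ + δ) ^ (-β) ≤ κ := by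
      have hb : X τ ^ β ≤ (X τ + δ) ^ β := Real.rpow_le_rpow hXτ (by linarith) (by linarith)
      calc X' τ * (X τ + δ) ^ (-β) ≤ κ * X τ ^ β * (X τ + δ) ^ (-β) :=
            mul_le_mul_of_nonneg_right (hX' τ hτ) (Real.rpow_nonneg hp.le _)
        _ ≤ κ * (X τ + δ) ^ β * (X τ + δ) ^ (-β) :=
            mul_le_mul_of_nonneg_right (mul_le_mul_of_nonneg_left hb hκ) (Real.rpow_nonneg hp.le _)
        _ = κ := by
            rw [mul_assoc, ← Real.rpow_add hp, add_neg_cancel, Real.rpow_zero, mul_one]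
    nlinarith [h1]
  have hmono : MonotoneOn φ (Icc a b) := by
    refine monotoneOn_of_deriv_nonneg (convex_Icc a b) hφc ?_ ?_
    · rw [interior_Icc]
      exact fun τ hτ => (hφd τ hτ).differentiableAt.differentiableWithinAt
    · rw [interior_Icc]
      intro τ hτ
      rw [(hφd τ hτ).deriv]
      exact hφ' τ hτ
  have h := hmono (left_mem_Icc.2 hab.le) ht ht.1
  simp only [hφ] at h
  linarith

omit [Fintype d] [DecidableEq d] in
/-- **Abstract window bound** for `X' ≤ κ X^{1+γ}` (`γ > 0`, `κ ≥ 0`, `X ≥ 0` continuous on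
`[a, b]`): if `γ κ (b − a) X(a)^γ ≤ 1/2` then `X(t) ≤ 2^{1/γ} X(a)` on `[a, b]`
(Robinson–Sadowski–Silva 2012, (4.1)). [folklore] -/
private theorem le_rpow_mul_of_window {X X' : ℝ → ℝ} {a b κ γ : ℝ} (hab : a < b) (hκ : 0 ≤ κ)
    (hγ : 0 < γ) (hX0 : ∀ t ∈ Icc a b, 0 ≤ X t) (hXc : ContinuousOn X (Icc a b))
    (hXd : ∀ t ∈ Ioo a b, HasDerivAt X (X' t) t) (hX' : ∀ t ∈ Ioo a b, X' t ≤ κ * X t ^ (1 + γ))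
    (hsmall : γ * κ * (b - a) * X a ^ γ ≤ 1 / 2) {t : ℝ} (ht : t ∈ Icc a b) :
    X t ≤ (2 : ℝ) ^ (1 / γ) * X a := by
  have hβ1 : (1 : ℝ) < 1 + γ := by linarith
  have hXa := hX0 a (left_mem_Icc.2 hab.le)
  have hXt' := hX0 t ht
  -- `γ κ (b − a) ≤ X(a)^{-γ} / 2` when `X(a) > 0`
  have hTκ : 0 < X a → γ * κ * (b - a) ≤ (X a) ^ (-γ) / 2 := by
    intro hXa0
    have hXγ : 0 < X a ^ γ := Real.rpow_pos_of_pos hXa0 γ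
    have hXγne : X a ^ γ ≠ 0 := hXγ.ne'
    rw [Real.rpow_neg hXa, le_div_iff₀ (by norm_num : (0:ℝ) < 2)]
    have h1 : γ * κ * (b - a) ≤ 1 / 2 / X a ^ γ := (le_div_iff₀ hXγ).2 hsmall
    calc γ * κ * (b - a) * 2 ≤ 1 / 2 / X a ^ γ * 2 :=
          mul_le_mul_of_nonneg_right h1 (by norm_num)
      _ = (X a ^ γ)⁻¹ := by field_simp
  have hcomp := fun (δ : ℝ) (hδ : 0 < δ) =>
    rpow_add_le_of_deriv_le_hi (X := X) (X' := X') hab hκ hβ1 hX0 hXc hXd hX' hδ ht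
  have h1β : 1 - (1 + γ) = -γ := by ring
  have hβ1' : (1 + γ) - 1 = γ := by ring
  by_cases hXt : X t = 0
  · rw [hXt]; exact mul_nonneg (Real.rpow_nonneg (by norm_num) _) hXa
  have hXt0 : 0 < X t := lt_of_le_of_ne hXt' (Ne.symm hXt)
  have htT : ((1 + γ) - 1) * κ * (t - a) ≤ γ * κ * (b - a) := by
    rw [hβ1']
    exact mul_le_mul_of_nonneg_left (by linarith [ht.2]) (mul_nonneg hγ.le hκ)
  have hkey : ∀ δ : ℝ, 0 < δ → (X a + δ) ^ (-γ) ≤ X t ^ (-γ) + γ * κ * (b - a) := by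
    intro δ hδ
    have h1 := hcomp δ hδ
    rw [h1β] at h1
    have h2 : (X t + δ) ^ (-γ) ≤ X t ^ (-γ) :=
      Real.rpow_le_rpow_of_nonpos hXt0 (by linarith) (by linarith)
    linarith
  have hXa0 : 0 < X a := by
    by_contra hcon
    have hX0z : X a = 0 := le_antisymm (not_lt.1 hcon) hXa
    set R₀ : ℝ := X t ^ (-γ) + γ * κ * (b - a) + 1 with hR₀
    have hR₀0 : 0 < R₀ := by
      have := Real.rpow_nonneg hXt' (-γ)
      have := mul_nonneg (mul_nonneg hγ.le hκ) (by linarith : (0 : ℝ) ≤ b - a)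
      rw [hR₀]; linarith
    set δ : ℝ := R₀ ^ (-(1 / γ)) with hδ
    have hδ0 : 0 < δ := Real.rpow_pos_of_pos hR₀0 _
    have hδγ : δ ^ (-γ) = R₀ := by
      rw [hδ, ← Real.rpow_mul hR₀0.le, show -(1 / γ) * -γ = 1 by field_simp, Real.rpow_one]
    have := hkey δ hδ0
    rw [hX0z, zero_add, hδγ, hR₀] at this
    linarith
  have hlim : (X a) ^ (-γ) ≤ X t ^ (-γ) + γ * κ * (b - a) := by
    by_contra hcon
    push Not at hcon
    have hcont : Filter.Tendsto (fun δ : ℝ => (X a + δ) ^ (-γ)) (𝓝 0) (𝓝 ((X a) ^ (-γ))) := by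
      have h1 : ContinuousAt (fun δ : ℝ => (X a + δ) ^ (-γ)) 0 :=
        (continuousAt_const.add continuousAt_id).rpow_const (Or.inl (by simp; exact hXa0.ne'))
      have h2 := h1.tendsto
      simp only [add_zero] at h2
      exact h2
    have hev := (hcont.eventually_const_lt hcon).filter_mono (nhdsWithin_le_nhds (s := Ioi (0:ℝ)))
    obtain ⟨δ, hδ0, hδ⟩ := ((eventually_mem_nhdsWithin (a := (0:ℝ)) (s := Ioi 0)).and hev).exists
    exact absurd (hkey δ hδ0) (not_le.2 hδ)
  have hXtγ : (X a) ^ (-γ) / 2 ≤ X t ^ (-γ) := by linarith [hTκ hXa0]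
  have hX0γ : 0 < (X a) ^ (-γ) / 2 := by
    have := Real.rpow_pos_of_pos hXa0 (-γ); linarith
  calc X t = (X t ^ (-γ)) ^ (-(1 / γ)) := by
        rw [← Real.rpow_mul hXt', show -γ * -(1 / γ) = 1 by field_simp, Real.rpow_one]
    _ ≤ ((X a) ^ (-γ) / 2) ^ (-(1 / γ)) :=
        Real.rpow_le_rpow_of_nonpos hX0γ hXtγ (by rw [neg_nonpos]; positivity)
    _ = (2 : ℝ) ^ (1 / γ) * X a := by
        rw [Real.div_rpow (Real.rpow_nonneg hXa _) (by norm_num), ← Real.rpow_mul hXa,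
          show -γ * -(1 / γ) = 1 by field_simp, Real.rpow_one, div_eq_mul_inv, ← Real.rpow_neg
          (by norm_num : (0:ℝ) ≤ 2), neg_neg, mul_comm]

/-- **Lemma 2.2 of Robinson–Sadowski–Silva (lifespan in `Ḣ^s`, `s > 5/2`), window form on `T³`.**
For `card d = 3` and every `s > 5/2` there is `c₁ = c₁(s) > 0` such that for every `ν > 0` and
every classical mean-zero solution of the unforced equations on `[a, b] × T³` with
`(b − a) · (∫‖u(a)‖²)^{(2s−5)/(4s)} · (‖u(a)‖²_{Ḣ^s})^{5/(4s)} ≤ c₁`, i.e.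
`b − a ≤ c₁ ‖u(a)‖₂^{−(2s−5)/(2s)} ‖u(a)‖_{Ḣ^s}^{−5/(2s)}` (RSS: "`T_s(u₀) ≥ c_s ‖u₀‖_{L²}^{(5−2s)/2s}
‖u₀‖_{Ḣ^s}^{−5/2s}`"), one has `‖u(t)‖²_{Ḣ^s} ≤ 2^{4s/5} ‖u(a)‖²_{Ḣ^s}` on `[a, b]` — uniformly in
`ν` (energy decay `‖u(t)‖₂ ≤ ‖u(a)‖₂` and comparison for
`NSSobolev.hsSeminorm_sq_deriv_le_of_gt_five_halves`).
[cite: RobinsonSadowskiSilva2012, Lemma 2.2] -/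
theorem hsSeminorm_sq_le_of_window_of_gt_five_halves' (hd : Fintype.card d = 3) {s : ℝ}
    (hs : 5 / 2 < s) :
    ∃ c₁ : ℝ, 0 < c₁ ∧ ∀ {ν a b : ℝ}, 0 < ν → a < b →
      ∀ {u : ℝ → UnitAddTorus d → EuclideanSpace ℝ d} {p : ℝ → UnitAddTorus d → ℝ},
      Torus.IsClassicalNSSolutionOn (Icc a b) ν 0 u p → (∀ t ∈ Icc a b, HasZeroMean (u t)) →
      (b - a) * (∫ x, ‖u a x‖ ^ 2) ^ ((2 * s - 5) / (4 * s)) *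
          (∑' k : d → ℤ, freqNormSq k ^ s *
            ‖mFourierCoeff (EuclideanSpace.complexify ∘ u a) k‖ ^ 2) ^ (5 / (4 * s)) ≤ c₁ →
      ∀ t ∈ Icc a b, (∑' k : d → ℤ, freqNormSq k ^ s *
          ‖mFourierCoeff (EuclideanSpace.complexify ∘ u t) k‖ ^ 2) ≤
        (2 : ℝ) ^ (4 * s / 5) * ∑' k : d → ℤ, freqNormSq k ^ s *
          ‖mFourierCoeff (EuclideanSpace.complexify ∘ u a) k‖ ^ 2 := by
  classical
  have hn : (Fintype.card d : ℝ) = 3 := by rw [hd]; norm_num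
  have hs0 : (0 : ℝ) < s := by linarith
  obtain ⟨K, hK0, hK⟩ := hsSeminorm_sq_deriv_le_of_gt_five_halves' hd hs
  obtain ⟨n, hn'⟩ := exists_nat_gt s
  set γ : ℝ := 5 / (4 * s) with hγ
  set θ : ℝ := (2 * s - 5) / (4 * s) with hθ
  have hγ0 : 0 < γ := by rw [hγ]; positivity
  have hθ0 : 0 ≤ θ := by rw [hθ]; exact div_nonneg (by linarith) (by positivity)
  have hβ : (4 * s + 5) / (4 * s) = 1 + γ := by rw [hγ]; field_simp
  set c₁ : ℝ := 1 / (2 * γ * (K + 1)) with hc₁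
  have hc₁0 : 0 < c₁ := by rw [hc₁]; positivity
  refine ⟨c₁, hc₁0, fun {ν a b} hν hab {u p} h hmean hsmall t ht => ?_⟩
  set Ea : ℝ := ∫ x, ‖u a x‖ ^ 2 with hEa
  have hEa0 : 0 ≤ Ea := integral_nonneg fun x => sq_nonneg _
  set κ : ℝ := K * Ea ^ θ with hκ
  have hκ0 : 0 ≤ κ := mul_nonneg hK0 (Real.rpow_nonneg hEa0 _)
  set X : ℝ → ℝ := fun τ => ∑' k : d → ℤ, freqNormSq k ^ s *
    ‖mFourierCoeff (EuclideanSpace.complexify ∘ u τ) k‖ ^ 2 with hX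
  have hXnn : ∀ τ, 0 ≤ X τ := fun τ => tsum_nonneg fun k =>
    mul_nonneg (Real.rpow_nonneg (freqNormSq_nonneg k) _) (sq_nonneg _)
  show X t ≤ (2 : ℝ) ^ (4 * s / 5) * X a
  have hXc : ContinuousOn X (Icc a b) :=
    continuousOn_tsum_rpow_mul_norm_sq_of_lt n hab h.smooth_velocity hs0 (by rw [hn]; linarith)
  -- energy decay on the window
  have hE : ∀ τ ∈ Icc a b, ∫ x, ‖u τ x‖ ^ 2 ≤ Ea := by
    intro τ hτ
    have hK' := kineticEnergy_le_of_le hν.le h (convex_Icc a b) hτ.1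
      (fun r hr => ⟨hr.1, hr.2.trans hτ.2⟩)
    unfold Torus.kineticEnergy at hK'
    rw [hEa]
    linarith
  have hXd : ∀ τ ∈ Ioo a b, HasDerivAt X (deriv X τ) τ ∧ deriv X τ ≤ κ * X τ ^ (1 + γ) := by
    intro τ hτ
    obtain ⟨D, hD, hle⟩ := hK hν hab h hmean τ hτ
    refine ⟨hD.differentiableAt.hasDerivAt, ?_⟩
    rw [hD.deriv]
    refine hle.trans ?_
    have hZ0 : 0 ≤ ∑' k : d → ℤ, freqNormSq k ^ (s + 1) *
        ‖mFourierCoeff (EuclideanSpace.complexify ∘ u τ) k‖ ^ 2 := tsum_nonneg fun k =>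
      mul_nonneg (Real.rpow_nonneg (freqNormSq_nonneg k) _) (sq_nonneg _)
    have hneg : -(8 * Real.pi ^ 2 * ν) * (∑' k : d → ℤ, freqNormSq k ^ (s + 1) *
        ‖mFourierCoeff (EuclideanSpace.complexify ∘ u τ) k‖ ^ 2) ≤ 0 :=
      mul_nonpos_of_nonpos_of_nonneg (by have := Real.pi_pos; nlinarith [hν]) hZ0
    have hEθ : (∫ x, ‖u τ x‖ ^ 2) ^ θ ≤ Ea ^ θ :=
      Real.rpow_le_rpow (integral_nonneg fun x => sq_nonneg _) (hE τ (Ioo_subset_Icc_self hτ)) hθ0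
    have hmain : K * (∫ x, ‖u τ x‖ ^ 2) ^ ((2 * s - 5) / (4 * s)) *
        X τ ^ ((4 * s + 5) / (4 * s)) ≤ κ * X τ ^ (1 + γ) := by
      rw [hβ, hκ, ← hθ]
      exact mul_le_mul_of_nonneg_right (mul_le_mul_of_nonneg_left hEθ hK0)
        (Real.rpow_nonneg (hXnn τ) _)
    linarith [hmain]
  -- the smallness condition of the abstract window lemma
  have hsm : γ * κ * (b - a) * X a ^ γ ≤ 1 / 2 := by
    have h1 : (b - a) * Ea ^ θ * X a ^ γ ≤ c₁ := hsmall
    have h2 : 0 ≤ (b - a) * Ea ^ θ * X a ^ γ :=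
      mul_nonneg (mul_nonneg (by linarith) (Real.rpow_nonneg hEa0 _)) (Real.rpow_nonneg (hXnn a) _)
    calc γ * κ * (b - a) * X a ^ γ = γ * K * ((b - a) * Ea ^ θ * X a ^ γ) := by rw [hκ]; ring
      _ ≤ γ * (K + 1) * c₁ :=
          mul_le_mul (mul_le_mul_of_nonneg_left (by linarith) hγ0.le) h1 h2 (by positivity)
      _ = 1 / 2 := by rw [hc₁]; field_simp
  have hres := le_rpow_mul_of_window (X := X) (X' := deriv X) hab hκ0 hγ0 (fun τ _ => hXnn τ) hXc
    (fun τ hτ => (hXd τ hτ).1) (fun τ hτ => (hXd τ hτ).2) hsm ht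
  have e : (1 : ℝ) / γ = 4 * s / 5 := by rw [hγ]; field_simp
  rw [e] at hres
  exact hres

/-- **The blow-up rate (2.3) of Robinson–Sadowski–Silva for `s > 5/2`** ("if the solution blows
up at time `T` then `‖u(T − t)‖_{Ḣ^s} ≥ c_s ‖u(T − t)‖_{L²}^{(5−2s)/5} t^{−2s/5}`", after
Benameur), classical torus form under unboundedness of the `Ḣ^s` energy: for `card d = 3` and
every `s > 5/2` there is `c₁ = c₁(s) > 0` such that every classical mean-zero solution on
`[a, T) × T³` (zero force) whose `Ḣ^s` energy `X(t) = ∑|k|^{2s}‖û(t,k)‖²` is unbounded on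
`[a, T)` satisfies, for all `t ∈ [a, T)`,
`X(t) ≥ (c₁ / ((T − t) (∫‖u(t)‖²)^{(2s−5)/(4s)}))^{4s/5}`,
i.e. `‖u(t)‖_{Ḣ^s} ≥ c ‖u(t)‖₂^{−(2s−5)/5} (T − t)^{−2s/5}` — independent of `ν`
(the window bound `NSSobolev.hsSeminorm_sq_le_of_window_of_gt_five_halves` on `[t, b']`, `b' < T`,
and continuity on `[a, t]`). [cite: RobinsonSadowskiSilva2012, Lemma 2.2 (2.3)] -/
theorem hsSeminorm_sq_blowup_rate_of_gt_five_halves' (hd : Fintype.card d = 3) {s : ℝ}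
    (hs : 5 / 2 < s) :
    ∃ c₁ : ℝ, 0 < c₁ ∧ ∀ {ν a T : ℝ}, 0 < ν →
      ∀ {u : ℝ → UnitAddTorus d → EuclideanSpace ℝ d} {p : ℝ → UnitAddTorus d → ℝ},
      Torus.IsClassicalNSSolutionOn (Ico a T) ν 0 u p → (∀ t ∈ Ico a T, HasZeroMean (u t)) →
      ¬ BddAbove ((fun t => ∑' k : d → ℤ, freqNormSq k ^ s *
          ‖mFourierCoeff (EuclideanSpace.complexify ∘ u t) k‖ ^ 2) '' Ico a T) →
      ∀ t ∈ Ico a T, (c₁ / ((T - t) * (∫ x, ‖u t x‖ ^ 2) ^ ((2 * s - 5) / (4 * s)))) ^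
          (4 * s / 5) ≤
        ∑' k : d → ℤ, freqNormSq k ^ s * ‖mFourierCoeff (EuclideanSpace.complexify ∘ u t) k‖ ^ 2 := by
  classical
  have hn : (Fintype.card d : ℝ) = 3 := by rw [hd]; norm_num
  have hs0 : (0 : ℝ) < s := by linarith
  obtain ⟨c₁, hc₁0, hW⟩ := hsSeminorm_sq_le_of_window_of_gt_five_halves' hd hs
  obtain ⟨n, hn'⟩ := exists_nat_gt s
  refine ⟨c₁, hc₁0, fun {ν a T} hν {u p} h hmean hunb t ht => ?_⟩
  set γ : ℝ := 5 / (4 * s) with hγ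
  set θ : ℝ := (2 * s - 5) / (4 * s) with hθ
  have hγ0 : 0 < γ := by rw [hγ]; positivity
  set X : ℝ → ℝ := fun τ => ∑' k : d → ℤ, freqNormSq k ^ s *
    ‖mFourierCoeff (EuclideanSpace.complexify ∘ u τ) k‖ ^ 2 with hX
  have hXnn : ∀ τ, 0 ≤ X τ := fun τ => tsum_nonneg fun k =>
    mul_nonneg (Real.rpow_nonneg (freqNormSq_nonneg k) _) (sq_nonneg _)
  set Et : ℝ := ∫ x, ‖u t x‖ ^ 2 with hEt
  have hEt0 : 0 ≤ Et := integral_nonneg fun x => sq_nonneg _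
  show (c₁ / ((T - t) * Et ^ θ)) ^ (4 * s / 5) ≤ X t
  have htT : 0 < T - t := by linarith [ht.2]
  have e1γ : (1 : ℝ) / γ = 4 * s / 5 := by rw [hγ]; field_simp
  by_contra hlt
  rw [not_le] at hlt
  -- then `(T - t) Et^θ X(t)^γ < c₁`
  have hsmall : (T - t) * Et ^ θ * X t ^ γ < c₁ := by
    rcases (Real.rpow_nonneg hEt0 θ).eq_or_lt with h0 | hpos
    · rw [← h0, mul_zero, zero_mul]; exact hc₁0
    · have hL0 : 0 < c₁ / ((T - t) * Et ^ θ) := div_pos hc₁0 (mul_pos htT hpos)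
      have h1 : X t ^ γ < ((c₁ / ((T - t) * Et ^ θ)) ^ (4 * s / 5)) ^ γ :=
        Real.rpow_lt_rpow (hXnn t) hlt hγ0
      rw [← Real.rpow_mul hL0.le, show 4 * s / 5 * γ = 1 by rw [hγ]; field_simp,
        Real.rpow_one] at h1
      calc (T - t) * Et ^ θ * X t ^ γ < (T - t) * Et ^ θ * (c₁ / ((T - t) * Et ^ θ)) :=
            mul_lt_mul_of_pos_left h1 (mul_pos htT hpos)
        _ = c₁ := by field_simp
  apply hunb
  have hright : ∀ τ ∈ Ico t T, X τ ≤ (2 : ℝ) ^ (4 * s / 5) * X t := by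
    intro τ hτ
    rcases hτ.1.eq_or_lt with h0 | htτ
    · rw [← h0]
      have : (1 : ℝ) ≤ (2 : ℝ) ^ (4 * s / 5) := Real.one_le_rpow (by norm_num) (by positivity)
      nlinarith [hXnn t]
    · set b : ℝ := (τ + T) / 2 with hb
      have hτb : τ < b := by rw [hb]; linarith [hτ.2]
      have hbT : b < T := by rw [hb]; linarith [hτ.2]
      have htb : t < b := htτ.trans hτb
      have hsub : Icc t b ⊆ Ico a T := fun r hr => ⟨ht.1.trans hr.1, lt_of_le_of_lt hr.2 hbT⟩
      have h' : Torus.IsClassicalNSSolutionOn (Icc t b) ν 0 u p := h.mono hsub (uniqueDiffOn_Icc htb)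
      have hsm : (b - t) * Et ^ θ * X t ^ γ ≤ c₁ := by
        have : (b - t) * Et ^ θ * X t ^ γ ≤ (T - t) * Et ^ θ * X t ^ γ :=
          mul_le_mul_of_nonneg_right (mul_le_mul_of_nonneg_right (by linarith)
            (Real.rpow_nonneg hEt0 _)) (Real.rpow_nonneg (hXnn t) _)
        linarith
      exact hW hν htb h' (fun r hr => hmean r (hsub hr)) hsm τ ⟨htτ.le, hτb.le⟩
  have hleft : BddAbove (X '' Icc a t) := by
    rcases ht.1.eq_or_lt with h0 | hat
    · rw [← h0, Set.Icc_self, Set.image_singleton]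
      exact bddAbove_singleton
    · have hsub : Icc a t ⊆ Ico a T := fun r hr => ⟨hr.1, lt_of_le_of_lt hr.2 ht.2⟩
      have h' : Torus.IsClassicalNSSolutionOn (Icc a t) ν 0 u p := h.mono hsub (uniqueDiffOn_Icc hat)
      have hXc : ContinuousOn X (Icc a t) :=
        continuousOn_tsum_rpow_mul_norm_sq_of_lt n hat h'.smooth_velocity hs0
          (by rw [hn]; linarith)
      exact (isCompact_Icc.image_of_continuousOn hXc).bddAbove
  obtain ⟨B₁, hB₁⟩ := hleft
  refine ⟨max B₁ ((2 : ℝ) ^ (4 * s / 5) * X t), ?_⟩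
  rintro _ ⟨τ, hτ, rfl⟩
  rcases le_or_gt τ t with hτt | htτ
  · exact (hB₁ ⟨τ, ⟨hτ.1, hτt⟩, rfl⟩).trans (le_max_left _ _)
  · exact (hright τ ⟨htτ.le, hτ.2⟩).trans (le_max_right _ _)

/-! ### §4 The first versions (`5/2 < s < 9/2`) as corollaries -/

/-- (Range `5/2 < s < 9/2`, the first version of this file; the unrestricted `s > 5/2`
statement is the primed theorem.) **The `Ḣ^s` energy inequality above `s = 5/2`** (Robinson–Sadowski–Silva 2012, Lemma 2.2 /
§VI in differential form; mechanism of §IV "now using (3.6) and (3.10)" with the interpolation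
pair `(0, s)`): for `card d = 3` and `5/2 < s < 9/2` there is `K = K(s) ≥ 0` such that for every
`ν > 0`, every classical solution `(u, p)` of `Torus.IsClassicalNSSolutionOn (Icc a b) ν 0 u p`
with mean-zero slices and every interior `t`, `X(τ) = ∑|k|^{2s}‖û(τ,k)‖²` is differentiable at
`t` and
`X'(t) ≤ −8π²ν ∑|k|^{2s+2}‖û(t,k)‖² + K (∫‖u(t)‖²)^{(2s−5)/(4s)} X(t)^{(4s+5)/(4s)}`
(`|2∑|k|^{2s}Re⟪𝓕((u·∇)u),û⟫| ≤ 2C₆ X ‖u‖_{F_1}`, (3.6), and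
`‖u‖_{F_1} ≤ C_I ‖u‖₂^{(2s−5)/(2s)} X^{5/(4s)}`, Lemma 3.2 at `r = 1`, levels `0 < 5/2 < s`). The
right-hand side is `ν`-free: the `Ḣ^s` lifespan for `s > 5/2` is at least
`c ‖u₀‖₂^{−(2s−5)/(2s)} ‖u₀‖_{Ḣ^s}^{−5/(2s)}` (RSS Lemma 2.2).
[cite: RobinsonSadowskiSilva2012, Lemma 2.2 with §III (3.6), (3.10)] -/
theorem hsSeminorm_sq_deriv_le_of_gt_five_halves (hd : Fintype.card d = 3) {s : ℝ}
    (hs : 5 / 2 < s) (hs' : s < 9 / 2) :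
    ∃ K : ℝ, 0 ≤ K ∧ ∀ {ν a b : ℝ}, 0 < ν → a < b →
      ∀ {u : ℝ → UnitAddTorus d → EuclideanSpace ℝ d} {p : ℝ → UnitAddTorus d → ℝ},
      Torus.IsClassicalNSSolutionOn (Icc a b) ν 0 u p → (∀ t ∈ Icc a b, HasZeroMean (u t)) →
      ∀ t ∈ Ioo a b, ∃ D : ℝ,
        HasDerivAt (fun τ => ∑' k : d → ℤ,
          freqNormSq k ^ s * ‖mFourierCoeff (EuclideanSpace.complexify ∘ u τ) k‖ ^ 2) D t ∧
        D ≤ -(8 * Real.pi ^ 2 * ν) *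
              (∑' k : d → ℤ, freqNormSq k ^ (s + 1) *
                ‖mFourierCoeff (EuclideanSpace.complexify ∘ u t) k‖ ^ 2) +
            K * (∫ x, ‖u t x‖ ^ 2) ^ ((2 * s - 5) / (4 * s)) *
              (∑' k : d → ℤ, freqNormSq k ^ s *
                ‖mFourierCoeff (EuclideanSpace.complexify ∘ u t) k‖ ^ 2) ^
                  ((4 * s + 5) / (4 * s)) := by
  have _h := hs'
  exact hsSeminorm_sq_deriv_le_of_gt_five_halves' hd hs

/-- (Range `5/2 < s < 9/2`, the first version of this file; the unrestricted `s > 5/2`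
statement is the primed theorem.) **Lemma 2.2 of Robinson–Sadowski–Silva (lifespan in `Ḣ^s`, `s > 5/2`), window form on `T³`.**
For `card d = 3` and `5/2 < s < 9/2` there is `c₁ = c₁(s) > 0` such that for every `ν > 0` and
every classical mean-zero solution of the unforced equations on `[a, b] × T³` with
`(b − a) · (∫‖u(a)‖²)^{(2s−5)/(4s)} · (‖u(a)‖²_{Ḣ^s})^{5/(4s)} ≤ c₁`, i.e.
`b − a ≤ c₁ ‖u(a)‖₂^{−(2s−5)/(2s)} ‖u(a)‖_{Ḣ^s}^{−5/(2s)}` (RSS: "`T_s(u₀) ≥ c_s ‖u₀‖_{L²}^{(5−2s)/2s}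
‖u₀‖_{Ḣ^s}^{−5/2s}`"), one has `‖u(t)‖²_{Ḣ^s} ≤ 2^{4s/5} ‖u(a)‖²_{Ḣ^s}` on `[a, b]` — uniformly in
`ν` (energy decay `‖u(t)‖₂ ≤ ‖u(a)‖₂` and comparison for
`NSSobolev.hsSeminorm_sq_deriv_le_of_gt_five_halves`).
[cite: RobinsonSadowskiSilva2012, Lemma 2.2] -/
theorem hsSeminorm_sq_le_of_window_of_gt_five_halves (hd : Fintype.card d = 3) {s : ℝ}
    (hs : 5 / 2 < s) (hs' : s < 9 / 2) :
    ∃ c₁ : ℝ, 0 < c₁ ∧ ∀ {ν a b : ℝ}, 0 < ν → a < b →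
      ∀ {u : ℝ → UnitAddTorus d → EuclideanSpace ℝ d} {p : ℝ → UnitAddTorus d → ℝ},
      Torus.IsClassicalNSSolutionOn (Icc a b) ν 0 u p → (∀ t ∈ Icc a b, HasZeroMean (u t)) →
      (b - a) * (∫ x, ‖u a x‖ ^ 2) ^ ((2 * s - 5) / (4 * s)) *
          (∑' k : d → ℤ, freqNormSq k ^ s *
            ‖mFourierCoeff (EuclideanSpace.complexify ∘ u a) k‖ ^ 2) ^ (5 / (4 * s)) ≤ c₁ →
      ∀ t ∈ Icc a b, (∑' k : d → ℤ, freqNormSq k ^ s *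
          ‖mFourierCoeff (EuclideanSpace.complexify ∘ u t) k‖ ^ 2) ≤
        (2 : ℝ) ^ (4 * s / 5) * ∑' k : d → ℤ, freqNormSq k ^ s *
          ‖mFourierCoeff (EuclideanSpace.complexify ∘ u a) k‖ ^ 2 := by
  have _h := hs'
  exact hsSeminorm_sq_le_of_window_of_gt_five_halves' hd hs

/-- (Range `5/2 < s < 9/2`, the first version of this file; the unrestricted `s > 5/2`
statement is the primed theorem.) **The blow-up rate (2.3) of Robinson–Sadowski–Silva for `s > 5/2`** ("if the solution blows
up at time `T` then `‖u(T − t)‖_{Ḣ^s} ≥ c_s ‖u(T − t)‖_{L²}^{(5−2s)/5} t^{−2s/5}`", after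
Benameur), classical torus form under unboundedness of the `Ḣ^s` energy: for `card d = 3` and
`5/2 < s < 9/2` there is `c₁ = c₁(s) > 0` such that every classical mean-zero solution on
`[a, T) × T³` (zero force) whose `Ḣ^s` energy `X(t) = ∑|k|^{2s}‖û(t,k)‖²` is unbounded on
`[a, T)` satisfies, for all `t ∈ [a, T)`,
`X(t) ≥ (c₁ / ((T − t) (∫‖u(t)‖²)^{(2s−5)/(4s)}))^{4s/5}`,
i.e. `‖u(t)‖_{Ḣ^s} ≥ c ‖u(t)‖₂^{−(2s−5)/5} (T − t)^{−2s/5}` — independent of `ν`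
(the window bound `NSSobolev.hsSeminorm_sq_le_of_window_of_gt_five_halves` on `[t, b']`, `b' < T`,
and continuity on `[a, t]`). [cite: RobinsonSadowskiSilva2012, Lemma 2.2 (2.3)] -/
theorem hsSeminorm_sq_blowup_rate_of_gt_five_halves (hd : Fintype.card d = 3) {s : ℝ}
    (hs : 5 / 2 < s) (hs' : s < 9 / 2) :
    ∃ c₁ : ℝ, 0 < c₁ ∧ ∀ {ν a T : ℝ}, 0 < ν →
      ∀ {u : ℝ → UnitAddTorus d → EuclideanSpace ℝ d} {p : ℝ → UnitAddTorus d → ℝ},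
      Torus.IsClassicalNSSolutionOn (Ico a T) ν 0 u p → (∀ t ∈ Ico a T, HasZeroMean (u t)) →
      ¬ BddAbove ((fun t => ∑' k : d → ℤ, freqNormSq k ^ s *
          ‖mFourierCoeff (EuclideanSpace.complexify ∘ u t) k‖ ^ 2) '' Ico a T) →
      ∀ t ∈ Ico a T, (c₁ / ((T - t) * (∫ x, ‖u t x‖ ^ 2) ^ ((2 * s - 5) / (4 * s)))) ^
          (4 * s / 5) ≤
        ∑' k : d → ℤ, freqNormSq k ^ s * ‖mFourierCoeff (EuclideanSpace.complexify ∘ u t) k‖ ^ 2 := by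
  have _h := hs'
  exact hsSeminorm_sq_blowup_rate_of_gt_five_halves' hd hs

/-! ### §5 The rate above `s = 5/2` under the classical (enstrophy) blow-up hypothesis -/

/-- **The `Ḣ^s` blow-up rate (2.3) for `s > 5/2` under unboundedness of `‖∇u‖₂`**
(Robinson–Sadowski–Silva 2012, Lemma 2.2 (2.3)), classical torus form: for `card d = 3` and
`s > 5/2` there is `c₁ = c₁(s) > 0` such that every classical mean-zero solution on `[a, T) × T³`
(zero force) with `‖∇u(t)‖₂²` unbounded on `[a, T)` satisfies
`∑|k|^{2s}‖û(t,k)‖² ≥ (c₁ / ((T − t)(∫‖u(t)‖²)^{(2s−5)/(4s)}))^{4s/5}` for all `t ∈ [a, T)`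
(mean zero and `s ≥ 1`: `‖∇u‖₂² ≤ 4π² ∑|k|^{2s}‖û‖²`, so the `Ḣ^s` energy is unbounded too; then
`NSSobolev.hsSeminorm_sq_blowup_rate_of_gt_five_halves'`).
[cite: RobinsonSadowskiSilva2012, Lemma 2.2 (2.3)] -/
theorem hsSeminorm_sq_blowup_rate_of_gt_five_halves_of_not_bddAbove_gradNormSq
    (hd : Fintype.card d = 3) {s : ℝ} (hs : 5 / 2 < s) :
    ∃ c₁ : ℝ, 0 < c₁ ∧ ∀ {ν a T : ℝ}, 0 < ν →
      ∀ {u : ℝ → UnitAddTorus d → EuclideanSpace ℝ d} {p : ℝ → UnitAddTorus d → ℝ},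
      Torus.IsClassicalNSSolutionOn (Ico a T) ν 0 u p → (∀ t ∈ Ico a T, HasZeroMean (u t)) →
      ¬ BddAbove ((fun t => Torus.gradNormSq (u t)) '' Ico a T) →
      ∀ t ∈ Ico a T, (c₁ / ((T - t) * (∫ x, ‖u t x‖ ^ 2) ^ ((2 * s - 5) / (4 * s)))) ^
          (4 * s / 5) ≤
        ∑' k : d → ℤ, freqNormSq k ^ s * ‖mFourierCoeff (EuclideanSpace.complexify ∘ u t) k‖ ^ 2 := by
  classical
  obtain ⟨c₁, hc₁, H⟩ := hsSeminorm_sq_blowup_rate_of_gt_five_halves' hd hs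
  refine ⟨c₁, hc₁, fun {ν a T} hν {u p} h hmean hunb t ht => H hν h hmean ?_ t ht⟩
  intro hbdd
  apply hunb
  obtain ⟨M, hM⟩ := hbdd
  refine ⟨4 * Real.pi ^ 2 * M, ?_⟩
  rintro _ ⟨τ, hτ, rfl⟩
  have hX : ∑' k : d → ℤ, freqNormSq k ^ s *
      ‖mFourierCoeff (EuclideanSpace.complexify ∘ u τ) k‖ ^ 2 ≤ M := hM ⟨τ, hτ, rfl⟩
  have huτ : IsSmooth (u τ) := h.smooth_velocity.isSmooth_slice hτ
  have hG := hasSum_freqNormSq_mul_norm_sq_mFourierCoeff huτ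
  have hXs := huτ.summable_freqNormSq_rpow_mul_norm_sq (by linarith : (0 : ℝ) ≤ s)
  have hle : Torus.gradNormSq (u τ) ≤ 4 * Real.pi ^ 2 * ∑' k : d → ℤ, freqNormSq k ^ s *
      ‖mFourierCoeff (EuclideanSpace.complexify ∘ u τ) k‖ ^ 2 := by
    rw [← hG.tsum_eq, ← tsum_mul_left]
    refine Summable.tsum_le_tsum (fun k => ?_) hG.summable (hXs.mul_left _)
    rw [← mul_assoc]
    refine mul_le_mul_of_nonneg_right (mul_le_mul_of_nonneg_left ?_ (by positivity)) (sq_nonneg _)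
    by_cases hk : k = 0
    · rw [hk, freqNormSq_zero, Real.zero_rpow (by linarith)]
    · calc freqNormSq k = freqNormSq k ^ (1 : ℝ) := (Real.rpow_one _).symm
        _ ≤ freqNormSq k ^ s :=
            Real.rpow_le_rpow_of_exponent_le (one_le_freqNormSq_of_ne_zero hk) (by linarith)
  show Torus.gradNormSq (u τ) ≤ 4 * Real.pi ^ 2 * M
  exact hle.trans (mul_le_mul_of_nonneg_left hX (by positivity))


/-! ### §6 The boundary case `s = 3/2` (RSS §V): rates arbitrarily close to `(T − t)^{-1/2}` -/

set_option maxHeartbeats 800000 in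
/-- **The `Ḣ^{3/2}` energy inequality with an `ε` of interpolation room** (Robinson–Sadowski–Silva
2012, §V.A: "Taking the inner product of equation (3.1) with `u` in `Ḣ^{3/2}` we obtain
`½ d/dt‖u‖²_{3/2} + ‖u‖²_{5/2} ≤ c‖u‖_{3/2}‖u‖_{5/2}‖u‖_F` … If we use the interpolation (3.10)
to bound `‖u‖_F` in terms of the norms in `Ḣ^{3/2−ε}` and `Ḣ^{3/2+}`, and then interpolate these
homogeneous Sobolev norms … which after using Young's inequality yields
`d/dt‖u‖²_{3/2} ≤ c‖u‖^{…}_{L²}‖u‖_{3/2}^{…}`"), classical torus form: for `card d = 3` and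
`0 < ε < 3/2` there is `c = c(ε) ≥ 0` such that along every classical mean-zero solution
(zero force, `ν > 0`), at interior times, `X = ∑|k|³‖û‖²` is differentiable and
`X' ≤ −4π²ν ∑|k|⁵‖û‖² + c ν^{−(1+2ε)} (∫‖u‖²)^{2ε/3} X^{2+ε/3}`
((3.5) `NSSobolev.sum_rpow_mul_norm_mul_norm_convect_le`; Lemma 3.2 at `r = 0` with levels
`(3/2 − ε, 5/2)`; `‖u‖²_{3/2−ε} ≤ ‖u‖₂^{4ε/3}‖u‖_{3/2}^{2−4ε/3}` (`Torus.tsum_rpow_mul_le_interpolate`);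
weighted AM–GM). The printed `ε_P ∈ (0, 1)` (levels `Ḣ^{3/2∓ε_P}`) is `ε = ε_P/(2 − ε_P)` here:
`4ε/3 = 4ε_P/(3(2−ε_P))`, `2 + ε/3 = 2 + ε_P/(3(2−ε_P))`.
[cite: RobinsonSadowskiSilva2012, §V.A (s = 3/2), p. 115618-10] -/
theorem hsSeminorm_sq_deriv_le_three_halves (hd : Fintype.card d = 3) {ε : ℝ} (hε : 0 < ε)
    (hε' : ε < 3 / 2) :
    ∃ c : ℝ, 0 ≤ c ∧ ∀ {ν a b : ℝ}, 0 < ν → a < b →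
      ∀ {u : ℝ → UnitAddTorus d → EuclideanSpace ℝ d} {p : ℝ → UnitAddTorus d → ℝ},
      Torus.IsClassicalNSSolutionOn (Icc a b) ν 0 u p → (∀ t ∈ Icc a b, HasZeroMean (u t)) →
      ∀ t ∈ Ioo a b, ∃ D : ℝ,
        HasDerivAt (fun τ => ∑' k : d → ℤ,
          freqNormSq k ^ (3 / 2 : ℝ) * ‖mFourierCoeff (EuclideanSpace.complexify ∘ u τ) k‖ ^ 2) D t ∧
        D ≤ -(4 * Real.pi ^ 2 * ν) *
              (∑' k : d → ℤ, freqNormSq k ^ ((3 / 2 : ℝ) + 1) *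
                ‖mFourierCoeff (EuclideanSpace.complexify ∘ u t) k‖ ^ 2) +
            c * ν ^ (-(1 + 2 * ε)) * (∫ x, ‖u t x‖ ^ 2) ^ (2 * ε / 3) *
              (∑' k : d → ℤ, freqNormSq k ^ (3 / 2 : ℝ) *
                ‖mFourierCoeff (EuclideanSpace.complexify ∘ u t) k‖ ^ 2) ^ (2 + ε / 3) := by
  classical
  have hn : (Fintype.card d : ℝ) = 3 := by rw [hd]; norm_num
  obtain ⟨CI, hCI0, hCI⟩ := exists_tsum_rpow_mul_norm_le_interpolation (d := d) (r := 0)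
    (s₁ := 3 / 2 - ε) (s₂ := 3 / 2 + 1) (by rw [hn]; linarith) (by rw [hn]; linarith)
  set CT : ℝ := 4 * Real.pi * (Fintype.card d : ℝ) ^ 2 * (2 : ℝ) ^ (3 / 2 : ℝ) with hCT
  have hCT0 : 0 ≤ CT := by rw [hCT]; positivity
  -- exponents
  set q : ℝ := (1 + 2 * ε) / (2 * (1 + ε)) with hq
  have h1ε : 0 < 1 + ε := by linarith
  have hq0 : 0 < q := by rw [hq]; positivity
  have hq1 : q < 1 := by rw [hq, div_lt_one (by positivity)]; linarith
  have h1q : 1 - q = 1 / (2 * (1 + ε)) := by rw [hq]; field_simp; ring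
  have h1q0 : 0 < 1 - q := by linarith
  set K : ℝ := 2 * CT * CI with hK
  have hK0 : 0 ≤ K := by positivity
  set c : ℝ := (K * (4 * Real.pi ^ 2) ^ (-q)) ^ (1 / (1 - q)) with hc
  have hc0 : 0 ≤ c := Real.rpow_nonneg (mul_nonneg hK0 (Real.rpow_nonneg (by positivity) _)) _
  refine ⟨c, hc0, fun {ν a b} hν hab {u p} h hmean t ht => ?_⟩
  have hU : UniqueDiffOn ℝ (Icc a b) := uniqueDiffOn_Icc hab
  have htS : t ∈ Icc a b := Ioo_subset_Icc_self ht
  have hut : IsSmooth (u t) := h.smooth_velocity.isSmooth_slice htS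
  refine ⟨_, hasDerivAt_tsum_rpow_mul_norm_sq_of_lt 1 hab h.smooth_velocity (by norm_num)
    (by rw [hn]; norm_num) ht, ?_⟩
  -- notation
  set cf : (d → ℤ) → EuclideanSpace ℂ d :=
    fun k => mFourierCoeff (EuclideanSpace.complexify ∘ u t) k with hcf
  set w : (d → ℤ) → EuclideanSpace ℂ d :=
    fun k => mFourierCoeff (EuclideanSpace.complexify ∘ timeDerivWithin (Icc a b) u t) k with hw
  set B : (d → ℤ) → EuclideanSpace ℂ d :=
    fun k => mFourierCoeff (EuclideanSpace.complexify ∘ Torus.convect (u t) (u t)) k with hB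
  set X : ℝ := ∑' k, freqNormSq k ^ (3 / 2 : ℝ) * ‖cf k‖ ^ 2 with hX
  set Z : ℝ := ∑' k, freqNormSq k ^ ((3 / 2 : ℝ) + 1) * ‖cf k‖ ^ 2 with hZ
  set Y : ℝ := ∑' k, freqNormSq k ^ (3 / 2 - ε) * ‖cf k‖ ^ 2 with hY
  set F : ℝ := ∑' k, ‖cf k‖ with hF
  set E : ℝ := ∫ x, ‖u t x‖ ^ 2 with hE
  have hw0 : ∀ (r : ℝ) k, 0 ≤ freqNormSq k ^ r * ‖cf k‖ ^ 2 := fun r k =>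
    mul_nonneg (Real.rpow_nonneg (freqNormSq_nonneg k) _) (sq_nonneg _)
  have hsumX : Summable fun k => freqNormSq k ^ (3 / 2 : ℝ) * ‖cf k‖ ^ 2 :=
    hut.summable_freqNormSq_rpow_mul_norm_sq (by norm_num)
  have hsumZ : Summable fun k => freqNormSq k ^ ((3 / 2 : ℝ) + 1) * ‖cf k‖ ^ 2 :=
    hut.summable_freqNormSq_rpow_mul_norm_sq (by norm_num)
  have hX0 : 0 ≤ X := tsum_nonneg (hw0 _)
  have hZ0 : 0 ≤ Z := tsum_nonneg (hw0 _)
  have hY0 : 0 ≤ Y := tsum_nonneg (hw0 _)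
  have hF0 : 0 ≤ F := tsum_nonneg fun k => norm_nonneg _
  have hE0 : 0 ≤ E := integral_nonneg fun x => sq_nonneg _
  show ∑' k, freqNormSq k ^ (3 / 2 : ℝ) * (2 * (inner ℂ (w k) (cf k)).re) ≤
    -(4 * Real.pi ^ 2 * ν) * Z + c * ν ^ (-(1 + 2 * ε)) * E ^ (2 * ε / 3) * X ^ (2 + ε / 3)
  -- ### the modewise identity and the (3.5)-bound of the trilinear sum
  have hid : ∀ k, (inner ℂ (w k) (cf k)).re =
      -(ν * (4 * Real.pi ^ 2 * freqNormSq k)) * ‖cf k‖ ^ 2 - (inner ℂ (B k) (cf k)).re := by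
    intro k
    have h1 := h.re_inner_mFourierCoeff_timeDerivWithin hU htS k
    rw [mFourierCoeff_complexify_zero_force', inner_zero_left, Complex.zero_re, add_zero] at h1
    exact h1
  set Rk : (d → ℤ) → ℝ := fun k => freqNormSq k ^ (3 / 2 : ℝ) * ‖cf k‖ * ‖B k‖ with hR
  have hR0 : ∀ k, 0 ≤ Rk k := fun k =>
    mul_nonneg (mul_nonneg (Real.rpow_nonneg (freqNormSq_nonneg k) _) (norm_nonneg _)) (norm_nonneg _)
  have hRK : ∀ K' : Finset (d → ℤ), ∑ k ∈ K', Rk k ≤ CT * F * Real.sqrt X * Real.sqrt Z := by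
    intro K'
    have h1 := sum_rpow_mul_norm_mul_norm_convect_le hut (h.divFree t htS)
      (by norm_num : (0:ℝ) ≤ 3 / 2) K'
    refine h1.trans ?_
    have h2 : Real.sqrt (∑ k ∈ K', freqNormSq k ^ ((3 / 2 : ℝ) + 1) * ‖cf k‖ ^ 2) ≤ Real.sqrt Z :=
      Real.sqrt_le_sqrt (sum_le_hasSum K' (fun k _ => hw0 _ k) hsumZ.hasSum)
    exact mul_le_mul_of_nonneg_left h2 (mul_nonneg (mul_nonneg hCT0 hF0) (Real.sqrt_nonneg _))
  have hRs : Summable Rk := summable_of_sum_le hR0 hRK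
  have hRle : ∑' k, Rk k ≤ CT * F * Real.sqrt X * Real.sqrt Z := Real.tsum_le_of_sum_le hR0 hRK
  set Qk : (d → ℤ) → ℝ := fun k => freqNormSq k ^ (3 / 2 : ℝ) * (inner ℂ (B k) (cf k)).re with hQ
  have hQle : ∀ k, |Qk k| ≤ Rk k := fun k => by
    simp only [hQ, hR, abs_mul, abs_of_nonneg (Real.rpow_nonneg (freqNormSq_nonneg k) (3 / 2 : ℝ)),
      mul_assoc]
    exact mul_le_mul_of_nonneg_left
      ((Complex.abs_re_le_norm _).trans ((norm_inner_le_norm (B k) (cf k)).trans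
        (le_of_eq (mul_comm _ _))))
      (Real.rpow_nonneg (freqNormSq_nonneg k) _)
  have hQs : Summable Qk := Summable.of_norm_bounded hRs fun k => (Real.norm_eq_abs _).le.trans (hQle k)
  have hterm : ∀ k, freqNormSq k ^ (3 / 2 : ℝ) * (2 * (inner ℂ (w k) (cf k)).re) =
      -(8 * Real.pi ^ 2 * ν) * (freqNormSq k ^ ((3 / 2 : ℝ) + 1) * ‖cf k‖ ^ 2) - 2 * Qk k := by
    intro k
    rw [hid k]
    simp only [hQ]
    have e : freqNormSq k ^ ((3 / 2 : ℝ) + 1) = freqNormSq k ^ (3 / 2 : ℝ) * freqNormSq k := by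
      rw [Real.rpow_add' (freqNormSq_nonneg k) (by norm_num : (3 / 2 : ℝ) + 1 ≠ 0), Real.rpow_one]
    rw [e]
    ring
  have hD : ∑' k, freqNormSq k ^ (3 / 2 : ℝ) * (2 * (inner ℂ (w k) (cf k)).re) =
      -(8 * Real.pi ^ 2 * ν) * Z - 2 * ∑' k, Qk k := by
    rw [tsum_congr hterm, (hsumZ.mul_left _).tsum_sub (hQs.mul_left 2), tsum_mul_left,
      tsum_mul_left]
  rw [hD]
  have hQR : -(∑' k, Qk k) ≤ ∑' k, Rk k := by
    rw [← tsum_neg]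
    exact Summable.tsum_le_tsum (fun k => (neg_le_abs (Qk k)).trans (hQle k)) hQs.neg hRs
  -- ### `F ≤ C_I √Y^{1/(1+ε)} √Z^{ε/(1+ε)}` and `Y ≤ E^{2ε/3} X^{1−2ε/3}`
  have hFle : F ≤ CI * Real.sqrt Y ^ (1 / (1 + ε)) * Real.sqrt Z ^ (ε / (1 + ε)) := by
    obtain ⟨-, hle⟩ := hCI (u t) (hut.memLp 2) (hmean t htS) hsumZ
    have e1 : (3 / 2 + 1 - 0 - (Fintype.card d : ℝ) / 2) / (3 / 2 + 1 - (3 / 2 - ε)) =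
        1 / (1 + ε) := by
      rw [hn, div_eq_div_iff (by linarith) (by linarith)]; ring
    have e2 : ((Fintype.card d : ℝ) / 2 + 0 - (3 / 2 - ε)) / (3 / 2 + 1 - (3 / 2 - ε)) =
        ε / (1 + ε) := by
      rw [hn, div_eq_div_iff (by linarith) (by linarith)]; ring
    rw [e1, e2] at hle
    simpa only [zero_div, Real.rpow_zero, one_mul] using hle
  have hYle : Y ≤ E ^ (2 * ε / 3) * X ^ (1 - 2 * ε / 3) := by
    have ha0 : ∀ k : d → ℤ, 0 ≤ ‖cf k‖ ^ 2 := fun k => sq_nonneg _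
    have h₁ : Summable fun k : d → ℤ => freqNormSq k ^ (0 : ℝ) * ‖cf k‖ ^ 2 :=
      (hasSum_sq_norm_mFourierCoeff_complexify (hut.memLp 2)).summable.congr fun k => by
        rw [Real.rpow_zero, one_mul]
    obtain ⟨-, hle⟩ := tsum_rpow_mul_le_interpolate (d := d) ha0 (s₁ := 0) (s₂ := 3 / 2)
      (θ := 2 * ε / 3) le_rfl (by norm_num) (by positivity) (by linarith) h₁ hsumX
    have e : 2 * ε / 3 * 0 + (1 - 2 * ε / 3) * (3 / 2) = 3 / 2 - ε := by ring
    rw [e] at hle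
    have eE : ∑' k : d → ℤ, freqNormSq k ^ (0 : ℝ) * ‖cf k‖ ^ 2 = E := by
      rw [tsum_congr fun k => by rw [Real.rpow_zero, one_mul]]
      exact (hasSum_sq_norm_mFourierCoeff_complexify (hut.memLp 2)).tsum_eq
    rw [eE] at hle
    exact hle
  -- ### assemble: `2 ∑ R ≤ K E^{ε/(3(1+ε))} X^{b} Z^{q}`, `b = 1/2 + (3−2ε)/(6(1+ε))`
  set bX : ℝ := 1 / 2 + (1 - 2 * ε / 3) / (2 * (1 + ε)) with hbX
  set aE : ℝ := (2 * ε / 3) / (2 * (1 + ε)) with haE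
  have hsY : Real.sqrt Y ^ (1 / (1 + ε)) ≤ (E ^ (2 * ε / 3) * X ^ (1 - 2 * ε / 3)) ^ (1 / (2 * (1 + ε))) := by
    rw [Real.sqrt_eq_rpow, ← Real.rpow_mul hY0, show (1 : ℝ) / 2 * (1 / (1 + ε)) = 1 / (2 * (1 + ε)) by
      field_simp]
    exact Real.rpow_le_rpow hY0 hYle (by positivity)
  have hmain : F * Real.sqrt X * Real.sqrt Z ≤
      CI * E ^ aE * X ^ bX * Z ^ q := by
    have hx0 : 0 ≤ Real.sqrt X := Real.sqrt_nonneg _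
    have hz0 : 0 ≤ Real.sqrt Z := Real.sqrt_nonneg _
    have h1 : F ≤ CI * (E ^ (2 * ε / 3) * X ^ (1 - 2 * ε / 3)) ^ (1 / (2 * (1 + ε))) *
        Real.sqrt Z ^ (ε / (1 + ε)) :=
      hFle.trans (mul_le_mul_of_nonneg_right (mul_le_mul_of_nonneg_left hsY hCI0)
        (Real.rpow_nonneg hz0 _))
    have e1 : (E ^ (2 * ε / 3) * X ^ (1 - 2 * ε / 3)) ^ (1 / (2 * (1 + ε))) = E ^ aE * X ^ (bX - 1 / 2) := by
      rw [Real.mul_rpow (Real.rpow_nonneg hE0 _) (Real.rpow_nonneg hX0 _), ← Real.rpow_mul hE0,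
        ← Real.rpow_mul hX0, haE, hbX]
      congr 1
      · congr 1; ring
      · congr 1; ring
    have e2 : X ^ (bX - 1 / 2) * Real.sqrt X = X ^ bX := by
      rw [Real.sqrt_eq_rpow, ← Real.rpow_add' hX0 (ne_of_gt (by
        have h1 : 0 < (1 - 2 * ε / 3) / (2 * (1 + ε)) := div_pos (by linarith) (by linarith)
        rw [hbX]; linarith))]
      congr 1; ring
    have e3 : Real.sqrt Z ^ (ε / (1 + ε)) * Real.sqrt Z = Z ^ q := by
      rw [Real.sqrt_eq_rpow, ← Real.rpow_mul hZ0, ← Real.rpow_add' hZ0 (ne_of_gt (by positivity)), hq]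
      congr 1; field_simp; ring
    calc F * Real.sqrt X * Real.sqrt Z
        ≤ CI * (E ^ (2 * ε / 3) * X ^ (1 - 2 * ε / 3)) ^ (1 / (2 * (1 + ε))) *
            Real.sqrt Z ^ (ε / (1 + ε)) * Real.sqrt X * Real.sqrt Z :=
          mul_le_mul_of_nonneg_right (mul_le_mul_of_nonneg_right h1 hx0) hz0
      _ = CI * (E ^ aE * (X ^ (bX - 1 / 2) * Real.sqrt X)) *
            (Real.sqrt Z ^ (ε / (1 + ε)) * Real.sqrt Z) := by rw [e1]; ring
      _ = CI * E ^ aE * X ^ bX * Z ^ q := by rw [e2, e3]; ring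
  have hfin : -(2 : ℝ) * ∑' k, Qk k ≤ K * E ^ aE * X ^ bX * Z ^ q := by
    calc -(2 : ℝ) * ∑' k, Qk k ≤ 2 * ∑' k, Rk k := by linarith [hQR]
      _ ≤ 2 * (CT * F * Real.sqrt X * Real.sqrt Z) := by linarith [hRle]
      _ = 2 * CT * (F * Real.sqrt X * Real.sqrt Z) := by ring
      _ ≤ 2 * CT * (CI * E ^ aE * X ^ bX * Z ^ q) := mul_le_mul_of_nonneg_left hmain (by positivity)
      _ = K * E ^ aE * X ^ bX * Z ^ q := by rw [hK]; ring
  -- ### Young: `K E^{aE} X^{bX} Z^q = (L Z)^q · M^{1−q}`, `L = 4π²ν`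
  set L : ℝ := 4 * Real.pi ^ 2 * ν with hL
  have hL0 : 0 < L := by rw [hL]; positivity
  have hLq : 0 < L ^ q := Real.rpow_pos_of_pos hL0 q
  have hKL0 : 0 ≤ K * L ^ (-q) * E ^ aE := mul_nonneg (mul_nonneg hK0 (Real.rpow_nonneg hL0.le _))
    (Real.rpow_nonneg hE0 _)
  set M : ℝ := (K * L ^ (-q) * E ^ aE) ^ (1 / (1 - q)) * X ^ (2 + ε / 3) with hM
  have hM0 : 0 ≤ M := mul_nonneg (Real.rpow_nonneg hKL0 _) (Real.rpow_nonneg hX0 _)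
  have hAMGM := Real.geom_mean_le_arith_mean2_weighted hq0.le h1q0.le (mul_nonneg hL0.le hZ0) hM0
    (by ring : q + (1 - q) = 1)
  have e3 : 1 / (1 - q) * (1 - q) = 1 := by rw [one_div, inv_mul_cancel₀ h1q0.ne']
  have e4 : (2 + ε / 3) * (1 - q) = bX := by rw [h1q, hbX]; field_simp; ring
  have hid2 : (L * Z) ^ q * M ^ (1 - q) = K * E ^ aE * X ^ bX * Z ^ q := by
    rw [hM, Real.mul_rpow hL0.le hZ0,
      Real.mul_rpow (Real.rpow_nonneg hKL0 _) (Real.rpow_nonneg hX0 _), ← Real.rpow_mul hKL0,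
      ← Real.rpow_mul hX0, e3, Real.rpow_one, e4, Real.rpow_neg hL0.le]
    calc L ^ q * Z ^ q * (K * (L ^ q)⁻¹ * E ^ aE * X ^ bX)
        = K * E ^ aE * X ^ bX * Z ^ q * (L ^ q * (L ^ q)⁻¹) := by ring
      _ = K * E ^ aE * X ^ bX * Z ^ q := by rw [mul_inv_cancel₀ hLq.ne', mul_one]
  -- `M = c ν^{−(1+2ε)} E^{2ε/3} X^{2+ε/3}`
  have e5 : -q * (1 / (1 - q)) = -(1 + 2 * ε) := by rw [h1q, hq]; field_simp
  have e6 : aE * (1 / (1 - q)) = 2 * ε / 3 := by rw [h1q, haE]; field_simp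
  have hMc : M = c * ν ^ (-(1 + 2 * ε)) * E ^ (2 * ε / 3) * X ^ (2 + ε / 3) := by
    have hP0 : 0 ≤ K * (4 * Real.pi ^ 2) ^ (-q) := mul_nonneg hK0 (Real.rpow_nonneg (by positivity) _)
    have hνq : 0 ≤ ν ^ (-q) := Real.rpow_nonneg hν.le _
    have hsplit : K * L ^ (-q) * E ^ aE = (K * (4 * Real.pi ^ 2) ^ (-q)) * ν ^ (-q) * E ^ aE := by
      rw [hL, Real.mul_rpow (by positivity : (0 : ℝ) ≤ 4 * Real.pi ^ 2) hν.le]; ring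
    rw [hM, hsplit, Real.mul_rpow (mul_nonneg hP0 hνq) (Real.rpow_nonneg hE0 _),
      Real.mul_rpow hP0 hνq, ← Real.rpow_mul hν.le, ← Real.rpow_mul hE0, e5, e6, hc]
  calc -(8 * Real.pi ^ 2 * ν) * Z - 2 * ∑' k, Qk k
      ≤ -(8 * Real.pi ^ 2 * ν) * Z + K * E ^ aE * X ^ bX * Z ^ q := by linarith [hfin]
    _ = -(8 * Real.pi ^ 2 * ν) * Z + (L * Z) ^ q * M ^ (1 - q) := by rw [hid2]
    _ ≤ -(8 * Real.pi ^ 2 * ν) * Z + (q * (L * Z) + (1 - q) * M) := by linarith [hAMGM]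
    _ ≤ -(8 * Real.pi ^ 2 * ν) * Z + (L * Z + M) := by
        nlinarith [mul_nonneg hL0.le hZ0, hM0, hq0, h1q0]
    _ = -(4 * Real.pi ^ 2 * ν) * Z + c * ν ^ (-(1 + 2 * ε)) * E ^ (2 * ε / 3) * X ^ (2 + ε / 3) := by
        rw [hMc, hL]
        ring


/-- **Lifespan in `Ḣ^{3/2}` up to `ε`** (Robinson–Sadowski–Silva 2012, §V.A: the differential
inequality "is in the form of equation (4.1)"), window form on `T³`: for `card d = 3` and
`0 < ε < 3/2` there is `c₁ = c₁(ε) > 0` such that for every `ν > 0` and every classical mean-zero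
solution of the unforced equations on `[a, b] × T³` with
`(b − a) · ν^{−(1+2ε)} (∫‖u(a)‖²)^{2ε/3} · (‖u(a)‖²_{Ḣ^{3/2}})^{1+ε/3} ≤ c₁`
one has `‖u(t)‖²_{Ḣ^{3/2}} ≤ 2^{3/(3+ε)} ‖u(a)‖²_{Ḣ^{3/2}}` on `[a, b]` (energy decay and comparison
for `NSSobolev.hsSeminorm_sq_deriv_le_three_halves`).
[cite: RobinsonSadowskiSilva2012, §V.A with (4.1)] -/
theorem hsSeminorm_sq_le_of_window_three_halves (hd : Fintype.card d = 3) {ε : ℝ} (hε : 0 < ε)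
    (hε' : ε < 3 / 2) :
    ∃ c₁ : ℝ, 0 < c₁ ∧ ∀ {ν a b : ℝ}, 0 < ν → a < b →
      ∀ {u : ℝ → UnitAddTorus d → EuclideanSpace ℝ d} {p : ℝ → UnitAddTorus d → ℝ},
      Torus.IsClassicalNSSolutionOn (Icc a b) ν 0 u p → (∀ t ∈ Icc a b, HasZeroMean (u t)) →
      (b - a) * (ν ^ (-(1 + 2 * ε)) * (∫ x, ‖u a x‖ ^ 2) ^ (2 * ε / 3)) *
          (∑' k : d → ℤ, freqNormSq k ^ (3 / 2 : ℝ) *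
            ‖mFourierCoeff (EuclideanSpace.complexify ∘ u a) k‖ ^ 2) ^ (1 + ε / 3) ≤ c₁ →
      ∀ t ∈ Icc a b, (∑' k : d → ℤ, freqNormSq k ^ (3 / 2 : ℝ) *
          ‖mFourierCoeff (EuclideanSpace.complexify ∘ u t) k‖ ^ 2) ≤
        (2 : ℝ) ^ (3 / (3 + ε)) * ∑' k : d → ℤ, freqNormSq k ^ (3 / 2 : ℝ) *
          ‖mFourierCoeff (EuclideanSpace.complexify ∘ u a) k‖ ^ 2 := by
  classical
  have hn : (Fintype.card d : ℝ) = 3 := by rw [hd]; norm_num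
  obtain ⟨K, hK0, hK⟩ := hsSeminorm_sq_deriv_le_three_halves hd hε hε'
  set γ : ℝ := 1 + ε / 3 with hγ
  set θ : ℝ := 2 * ε / 3 with hθ
  have hγ0 : 0 < γ := by rw [hγ]; positivity
  have hθ0 : 0 ≤ θ := by rw [hθ]; positivity
  have hβ : 2 + ε / 3 = 1 + γ := by rw [hγ]; ring
  set c₁ : ℝ := 1 / (2 * γ * (K + 1)) with hc₁
  have hc₁0 : 0 < c₁ := by rw [hc₁]; positivity
  refine ⟨c₁, hc₁0, fun {ν a b} hν hab {u p} h hmean hsmall t ht => ?_⟩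
  set Ea : ℝ := ∫ x, ‖u a x‖ ^ 2 with hEa
  have hEa0 : 0 ≤ Ea := integral_nonneg fun x => sq_nonneg _
  have hνa : 0 ≤ ν ^ (-(1 + 2 * ε)) := Real.rpow_nonneg hν.le _
  set κ : ℝ := K * (ν ^ (-(1 + 2 * ε)) * Ea ^ θ) with hκ
  have hκ0 : 0 ≤ κ := mul_nonneg hK0 (mul_nonneg hνa (Real.rpow_nonneg hEa0 _))
  set X : ℝ → ℝ := fun τ => ∑' k : d → ℤ, freqNormSq k ^ (3 / 2 : ℝ) *
    ‖mFourierCoeff (EuclideanSpace.complexify ∘ u τ) k‖ ^ 2 with hX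
  have hXnn : ∀ τ, 0 ≤ X τ := fun τ => tsum_nonneg fun k =>
    mul_nonneg (Real.rpow_nonneg (freqNormSq_nonneg k) _) (sq_nonneg _)
  show X t ≤ (2 : ℝ) ^ (3 / (3 + ε)) * X a
  have hXc : ContinuousOn X (Icc a b) :=
    continuousOn_tsum_rpow_mul_norm_sq_of_lt 1 hab h.smooth_velocity (by norm_num)
      (by rw [hn]; norm_num)
  -- energy decay on the window
  have hE : ∀ τ ∈ Icc a b, ∫ x, ‖u τ x‖ ^ 2 ≤ Ea := by
    intro τ hτ
    have hK' := kineticEnergy_le_of_le hν.le h (convex_Icc a b) hτ.1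
      (fun r hr => ⟨hr.1, hr.2.trans hτ.2⟩)
    unfold Torus.kineticEnergy at hK'
    rw [hEa]
    linarith
  have hXd : ∀ τ ∈ Ioo a b, HasDerivAt X (deriv X τ) τ ∧ deriv X τ ≤ κ * X τ ^ (1 + γ) := by
    intro τ hτ
    obtain ⟨D, hD, hle⟩ := hK hν hab h hmean τ hτ
    refine ⟨hD.differentiableAt.hasDerivAt, ?_⟩
    rw [hD.deriv]
    refine hle.trans ?_
    have hZ0 : 0 ≤ ∑' k : d → ℤ, freqNormSq k ^ ((3 / 2 : ℝ) + 1) *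
        ‖mFourierCoeff (EuclideanSpace.complexify ∘ u τ) k‖ ^ 2 := tsum_nonneg fun k =>
      mul_nonneg (Real.rpow_nonneg (freqNormSq_nonneg k) _) (sq_nonneg _)
    have hneg : -(4 * Real.pi ^ 2 * ν) * (∑' k : d → ℤ, freqNormSq k ^ ((3 / 2 : ℝ) + 1) *
        ‖mFourierCoeff (EuclideanSpace.complexify ∘ u τ) k‖ ^ 2) ≤ 0 :=
      mul_nonpos_of_nonpos_of_nonneg (by have := Real.pi_pos; nlinarith [hν]) hZ0
    have hEθ : (∫ x, ‖u τ x‖ ^ 2) ^ θ ≤ Ea ^ θ :=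
      Real.rpow_le_rpow (integral_nonneg fun x => sq_nonneg _) (hE τ (Ioo_subset_Icc_self hτ)) hθ0
    have hmain : K * ν ^ (-(1 + 2 * ε)) * (∫ x, ‖u τ x‖ ^ 2) ^ (2 * ε / 3) *
        X τ ^ (2 + ε / 3) ≤ κ * X τ ^ (1 + γ) := by
      rw [hβ, hκ, ← hθ]
      have h1 : K * ν ^ (-(1 + 2 * ε)) * (∫ x, ‖u τ x‖ ^ 2) ^ θ ≤
          K * (ν ^ (-(1 + 2 * ε)) * Ea ^ θ) := by
        rw [← mul_assoc]
        exact mul_le_mul_of_nonneg_left hEθ (mul_nonneg hK0 hνa)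
      exact mul_le_mul_of_nonneg_right h1 (Real.rpow_nonneg (hXnn τ) _)
    linarith [hmain]
  -- the smallness condition of the abstract window lemma
  have hsm : γ * κ * (b - a) * X a ^ γ ≤ 1 / 2 := by
    have h1 : (b - a) * (ν ^ (-(1 + 2 * ε)) * Ea ^ θ) * X a ^ γ ≤ c₁ := hsmall
    have h2 : 0 ≤ (b - a) * (ν ^ (-(1 + 2 * ε)) * Ea ^ θ) * X a ^ γ :=
      mul_nonneg (mul_nonneg (by linarith) (mul_nonneg hνa (Real.rpow_nonneg hEa0 _)))
        (Real.rpow_nonneg (hXnn a) _)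
    calc γ * κ * (b - a) * X a ^ γ
        = γ * K * ((b - a) * (ν ^ (-(1 + 2 * ε)) * Ea ^ θ) * X a ^ γ) := by rw [hκ]; ring
      _ ≤ γ * (K + 1) * c₁ :=
          mul_le_mul (mul_le_mul_of_nonneg_left (by linarith) hγ0.le) h1 h2 (by positivity)
      _ = 1 / 2 := by rw [hc₁]; field_simp
  have hres := le_rpow_mul_of_window (X := X) (X' := deriv X) hab hκ0 hγ0 (fun τ _ => hXnn τ) hXc
    (fun τ hτ => (hXd τ hτ).1) (fun τ hτ => (hXd τ hτ).2) hsm ht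
  have e : (1 : ℝ) / γ = 3 / (3 + ε) := by
    rw [hγ, div_eq_div_iff (by positivity) (by positivity)]; ring
  rw [e] at hres
  exact hres

/-- **The `Ḣ^{3/2}` blow-up rate, arbitrarily close to `(T − t)^{−1/2}`** (Robinson–Sadowski–Silva
2012, §V.A: "if the solution blows up at time `T*` then
`‖u(T* − t)‖_{3/2} ≥ c ‖u(T* − t)‖_{L²}^{−ε/(3−ε)} t^{−3(2−ε)/4(3−ε)}`; in particular the blowup
rate can be made as close to `t^{−1/2}` as required"), classical torus form under unboundedness
of the `Ḣ^{3/2}` energy, in the parametrisation of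
`NSSobolev.hsSeminorm_sq_deriv_le_three_halves`: for `card d = 3` and `0 < ε < 3/2` there is
`c₁ = c₁(ε) > 0` such that every classical mean-zero solution on `[a, T) × T³` (zero force,
`ν > 0`) whose `Ḣ^{3/2}` energy `X` is unbounded on `[a, T)` satisfies, for all `t ∈ [a, T)`,
`X(t) ≥ (c₁ ν^{1+2ε} / ((T − t)(∫‖u(t)‖²)^{2ε/3}))^{3/(3+ε)}`, i.e.
`‖u(t)‖_{Ḣ^{3/2}} ≳ ‖u(t)‖₂^{−2ε/(3+ε)} (T − t)^{−3/(2(3+ε))}`.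
[cite: RobinsonSadowskiSilva2012, §V.A with (4.2)] -/
theorem hsSeminorm_sq_blowup_rate_three_halves (hd : Fintype.card d = 3) {ε : ℝ} (hε : 0 < ε)
    (hε' : ε < 3 / 2) :
    ∃ c₁ : ℝ, 0 < c₁ ∧ ∀ {ν a T : ℝ}, 0 < ν →
      ∀ {u : ℝ → UnitAddTorus d → EuclideanSpace ℝ d} {p : ℝ → UnitAddTorus d → ℝ},
      Torus.IsClassicalNSSolutionOn (Ico a T) ν 0 u p → (∀ t ∈ Ico a T, HasZeroMean (u t)) →
      ¬ BddAbove ((fun t => ∑' k : d → ℤ, freqNormSq k ^ (3 / 2 : ℝ) *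
          ‖mFourierCoeff (EuclideanSpace.complexify ∘ u t) k‖ ^ 2) '' Ico a T) →
      ∀ t ∈ Ico a T,
        (c₁ / ((T - t) * (ν ^ (-(1 + 2 * ε)) * (∫ x, ‖u t x‖ ^ 2) ^ (2 * ε / 3)))) ^
            (3 / (3 + ε)) ≤
        ∑' k : d → ℤ, freqNormSq k ^ (3 / 2 : ℝ) *
          ‖mFourierCoeff (EuclideanSpace.complexify ∘ u t) k‖ ^ 2 := by
  classical
  have hn : (Fintype.card d : ℝ) = 3 := by rw [hd]; norm_num
  obtain ⟨c₁, hc₁0, hW⟩ := hsSeminorm_sq_le_of_window_three_halves hd hε hε'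
  refine ⟨c₁, hc₁0, fun {ν a T} hν {u p} h hmean hunb t ht => ?_⟩
  set γ : ℝ := 1 + ε / 3 with hγ
  set θ : ℝ := 2 * ε / 3 with hθ
  have hγ0 : 0 < γ := by rw [hγ]; positivity
  set X : ℝ → ℝ := fun τ => ∑' k : d → ℤ, freqNormSq k ^ (3 / 2 : ℝ) *
    ‖mFourierCoeff (EuclideanSpace.complexify ∘ u τ) k‖ ^ 2 with hX
  have hXnn : ∀ τ, 0 ≤ X τ := fun τ => tsum_nonneg fun k =>
    mul_nonneg (Real.rpow_nonneg (freqNormSq_nonneg k) _) (sq_nonneg _)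
  set Et : ℝ := ∫ x, ‖u t x‖ ^ 2 with hEt
  have hEt0 : 0 ≤ Et := integral_nonneg fun x => sq_nonneg _
  set Wt : ℝ := ν ^ (-(1 + 2 * ε)) * Et ^ θ with hWt
  have hWt0 : 0 ≤ Wt := mul_nonneg (Real.rpow_nonneg hν.le _) (Real.rpow_nonneg hEt0 _)
  show (c₁ / ((T - t) * Wt)) ^ (3 / (3 + ε)) ≤ X t
  have htT : 0 < T - t := by linarith [ht.2]
  have h3ε : 0 < 3 + ε := by linarith
  by_contra hlt
  rw [not_le] at hlt
  -- then `(T - t) Wt X(t)^γ < c₁`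
  have hsmall : (T - t) * Wt * X t ^ γ < c₁ := by
    rcases hWt0.eq_or_lt with h0 | hpos
    · rw [← h0, mul_zero, zero_mul]; exact hc₁0
    · have hL0 : 0 < c₁ / ((T - t) * Wt) := div_pos hc₁0 (mul_pos htT hpos)
      have h1 : X t ^ γ < ((c₁ / ((T - t) * Wt)) ^ (3 / (3 + ε))) ^ γ :=
        Real.rpow_lt_rpow (hXnn t) hlt hγ0
      rw [← Real.rpow_mul hL0.le, show 3 / (3 + ε) * γ = 1 by rw [hγ]; field_simp,
        Real.rpow_one] at h1
      calc (T - t) * Wt * X t ^ γ < (T - t) * Wt * (c₁ / ((T - t) * Wt)) :=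
            mul_lt_mul_of_pos_left h1 (mul_pos htT hpos)
        _ = c₁ := by field_simp
  apply hunb
  have hright : ∀ τ ∈ Ico t T, X τ ≤ (2 : ℝ) ^ (3 / (3 + ε)) * X t := by
    intro τ hτ
    rcases hτ.1.eq_or_lt with h0 | htτ
    · rw [← h0]
      have : (1 : ℝ) ≤ (2 : ℝ) ^ (3 / (3 + ε)) := Real.one_le_rpow (by norm_num) (by positivity)
      nlinarith [hXnn t]
    · set b : ℝ := (τ + T) / 2 with hb
      have hτb : τ < b := by rw [hb]; linarith [hτ.2]
      have hbT : b < T := by rw [hb]; linarith [hτ.2]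
      have htb : t < b := htτ.trans hτb
      have hsub : Icc t b ⊆ Ico a T := fun r hr => ⟨ht.1.trans hr.1, lt_of_le_of_lt hr.2 hbT⟩
      have h' : Torus.IsClassicalNSSolutionOn (Icc t b) ν 0 u p := h.mono hsub (uniqueDiffOn_Icc htb)
      have hsm : (b - t) * Wt * X t ^ γ ≤ c₁ := by
        have : (b - t) * Wt * X t ^ γ ≤ (T - t) * Wt * X t ^ γ :=
          mul_le_mul_of_nonneg_right (mul_le_mul_of_nonneg_right (by linarith) hWt0)
            (Real.rpow_nonneg (hXnn t) _)
        linarith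
      exact hW hν htb h' (fun r hr => hmean r (hsub hr)) hsm τ ⟨htτ.le, hτb.le⟩
  have hleft : BddAbove (X '' Icc a t) := by
    rcases ht.1.eq_or_lt with h0 | hat
    · rw [← h0, Set.Icc_self, Set.image_singleton]
      exact bddAbove_singleton
    · have hsub : Icc a t ⊆ Ico a T := fun r hr => ⟨hr.1, lt_of_le_of_lt hr.2 ht.2⟩
      have h' : Torus.IsClassicalNSSolutionOn (Icc a t) ν 0 u p := h.mono hsub (uniqueDiffOn_Icc hat)
      have hXc : ContinuousOn X (Icc a t) :=
        continuousOn_tsum_rpow_mul_norm_sq_of_lt 1 hat h'.smooth_velocity (by norm_num)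
          (by rw [hn]; norm_num)
      exact (isCompact_Icc.image_of_continuousOn hXc).bddAbove
  obtain ⟨B₁, hB₁⟩ := hleft
  refine ⟨max B₁ ((2 : ℝ) ^ (3 / (3 + ε)) * X t), ?_⟩
  rintro _ ⟨τ, hτ, rfl⟩
  rcases le_or_gt τ t with hτt | htτ
  · exact (hB₁ ⟨τ, ⟨hτ.1, hτt⟩, rfl⟩).trans (le_max_left _ _)
  · exact (hright τ ⟨htτ.le, hτ.2⟩).trans (le_max_right _ _)


/-! ### §7 The boundary case `s = 5/2` (RSS §V.A): rates arbitrarily close to `(T − t)^{-1}` -/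

set_option maxHeartbeats 800000 in
/-- **The `Ḣ^{5/2}` energy inequality with an `ε` of interpolation room** (Robinson–Sadowski–Silva
2012, §V.A, the case `s = 5/2`: the `Ḣ^{5/2}` inner product is bounded with (3.6) by
`c‖u‖²_{5/2}‖u‖_{F¹}`, `‖u‖_{F¹}` by the interpolation (3.10) between `Ḣ^{5/2−ε}` and `Ḣ^{7/2}`,
`Ḣ^{5/2−ε}` between `L²` and `Ḣ^{5/2}`, then Young), classical torus form: for `card d = 3` and
`0 < ε < 5/2` there is `c = c(ε) ≥ 0` such that along every classical mean-zero solution (zero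
force, `ν > 0`), at interior times, `X = ∑|k|⁵‖û‖²` is differentiable and
`X' ≤ −4π²ν ∑|k|⁷‖û‖² + c ν^{−ε/(2+ε)} (∫‖u‖²)^{2ε/(5(2+ε))} X^{(15+8ε)/(5(2+ε))}`
(`NSSobolev.abs_tsum_rpow_mul_re_inner_convect_le`; Lemma 3.2 at `r = 1` with levels
`(5/2 − ε, 7/2)`; `Torus.tsum_rpow_mul_le_interpolate` with levels `(0, 5/2)`; weighted AM–GM).
The printed `ε_P ∈ (0, 1)` (levels `Ḣ^{5/2∓ε_P}`) is `ε = ε_P/(2 − ε_P)` here: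
`4ε/(5(2+ε)) = 4ε_P/(5(4−ε_P))`.
[cite: RobinsonSadowskiSilva2012, §V.A (s = 5/2), p. 115618-11] -/
theorem hsSeminorm_sq_deriv_le_five_halves (hd : Fintype.card d = 3) {ε : ℝ} (hε : 0 < ε)
    (hε' : ε < 5 / 2) :
    ∃ c : ℝ, 0 ≤ c ∧ ∀ {ν a b : ℝ}, 0 < ν → a < b →
      ∀ {u : ℝ → UnitAddTorus d → EuclideanSpace ℝ d} {p : ℝ → UnitAddTorus d → ℝ},
      Torus.IsClassicalNSSolutionOn (Icc a b) ν 0 u p → (∀ t ∈ Icc a b, HasZeroMean (u t)) →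
      ∀ t ∈ Ioo a b, ∃ D : ℝ,
        HasDerivAt (fun τ => ∑' k : d → ℤ,
          freqNormSq k ^ (5 / 2 : ℝ) * ‖mFourierCoeff (EuclideanSpace.complexify ∘ u τ) k‖ ^ 2) D t ∧
        D ≤ -(4 * Real.pi ^ 2 * ν) *
              (∑' k : d → ℤ, freqNormSq k ^ ((5 / 2 : ℝ) + 1) *
                ‖mFourierCoeff (EuclideanSpace.complexify ∘ u t) k‖ ^ 2) +
            c * ν ^ (-(ε / (2 + ε))) * (∫ x, ‖u t x‖ ^ 2) ^ (2 * ε / (5 * (2 + ε))) *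
              (∑' k : d → ℤ, freqNormSq k ^ (5 / 2 : ℝ) *
                ‖mFourierCoeff (EuclideanSpace.complexify ∘ u t) k‖ ^ 2) ^
                  ((15 + 8 * ε) / (5 * (2 + ε))) := by
  classical
  have hn : (Fintype.card d : ℝ) = 3 := by rw [hd]; norm_num
  obtain ⟨CI, hCI0, hCI⟩ := exists_tsum_rpow_mul_norm_le_interpolation (d := d) (r := 1)
    (s₁ := 5 / 2 - ε) (s₂ := 5 / 2 + 1) (by rw [hn]; linarith) (by rw [hn]; linarith)
  set CT : ℝ := 4 * Real.pi * (Fintype.card d : ℝ) ^ 2 * (2 : ℝ) ^ (5 / 2 : ℝ) with hCT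
  have hCT0 : 0 ≤ CT := by rw [hCT]; positivity
  set C₆ : ℝ := 4 * Real.pi * (Fintype.card d : ℝ) * ((5 / 2 : ℝ) * (2 : ℝ) ^ (5 / 2 : ℝ)) with hC₆
  have hC₆0 : 0 ≤ C₆ := by rw [hC₆]; positivity
  -- exponents
  have h1ε : 0 < 1 + ε := by linarith
  have h2ε : 0 < 2 + ε := by linarith
  set q : ℝ := ε / (2 * (1 + ε)) with hq
  have hq0 : 0 < q := by rw [hq]; positivity
  have hq1 : q < 1 := by rw [hq, div_lt_one (by positivity)]; linarith
  have h1q : 1 - q = (2 + ε) / (2 * (1 + ε)) := by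
    rw [hq, eq_div_iff (by positivity)]; field_simp; ring
  have h1q0 : 0 < 1 - q := by linarith
  set K : ℝ := 2 * C₆ * CI with hK
  have hK0 : 0 ≤ K := by positivity
  set c : ℝ := (K * (4 * Real.pi ^ 2) ^ (-q)) ^ (1 / (1 - q)) with hc
  have hc0 : 0 ≤ c := Real.rpow_nonneg (mul_nonneg hK0 (Real.rpow_nonneg (by positivity) _)) _
  refine ⟨c, hc0, fun {ν a b} hν hab {u p} h hmean t ht => ?_⟩
  have hU : UniqueDiffOn ℝ (Icc a b) := uniqueDiffOn_Icc hab
  have htS : t ∈ Icc a b := Ioo_subset_Icc_self ht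
  have hut : IsSmooth (u t) := h.smooth_velocity.isSmooth_slice htS
  refine ⟨_, hasDerivAt_tsum_rpow_mul_norm_sq_of_lt 2 hab h.smooth_velocity (by norm_num)
    (by rw [hn]; norm_num) ht, ?_⟩
  -- notation
  set cf : (d → ℤ) → EuclideanSpace ℂ d :=
    fun k => mFourierCoeff (EuclideanSpace.complexify ∘ u t) k with hcf
  set w : (d → ℤ) → EuclideanSpace ℂ d :=
    fun k => mFourierCoeff (EuclideanSpace.complexify ∘ timeDerivWithin (Icc a b) u t) k with hw
  set B : (d → ℤ) → EuclideanSpace ℂ d :=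
    fun k => mFourierCoeff (EuclideanSpace.complexify ∘ Torus.convect (u t) (u t)) k with hB
  set X : ℝ := ∑' k, freqNormSq k ^ (5 / 2 : ℝ) * ‖cf k‖ ^ 2 with hX
  set Z : ℝ := ∑' k, freqNormSq k ^ ((5 / 2 : ℝ) + 1) * ‖cf k‖ ^ 2 with hZ
  set Y : ℝ := ∑' k, freqNormSq k ^ (5 / 2 - ε) * ‖cf k‖ ^ 2 with hY
  set F : ℝ := ∑' k, ‖cf k‖ with hF
  set F₁ : ℝ := ∑' k, Real.sqrt (freqNormSq k) * ‖cf k‖ with hF₁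
  set E : ℝ := ∫ x, ‖u t x‖ ^ 2 with hE
  have hw0 : ∀ (r : ℝ) k, 0 ≤ freqNormSq k ^ r * ‖cf k‖ ^ 2 := fun r k =>
    mul_nonneg (Real.rpow_nonneg (freqNormSq_nonneg k) _) (sq_nonneg _)
  have hsumX : Summable fun k => freqNormSq k ^ (5 / 2 : ℝ) * ‖cf k‖ ^ 2 :=
    hut.summable_freqNormSq_rpow_mul_norm_sq (by norm_num)
  have hsumZ : Summable fun k => freqNormSq k ^ ((5 / 2 : ℝ) + 1) * ‖cf k‖ ^ 2 :=
    hut.summable_freqNormSq_rpow_mul_norm_sq (by norm_num)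
  have hX0 : 0 ≤ X := tsum_nonneg (hw0 _)
  have hZ0 : 0 ≤ Z := tsum_nonneg (hw0 _)
  have hY0 : 0 ≤ Y := tsum_nonneg (hw0 _)
  have hF0 : 0 ≤ F := tsum_nonneg fun k => norm_nonneg _
  have hF₁0 : 0 ≤ F₁ := tsum_nonneg fun k => mul_nonneg (Real.sqrt_nonneg _) (norm_nonneg _)
  have hE0 : 0 ≤ E := integral_nonneg fun x => sq_nonneg _
  show ∑' k, freqNormSq k ^ (5 / 2 : ℝ) * (2 * (inner ℂ (w k) (cf k)).re) ≤
    -(4 * Real.pi ^ 2 * ν) * Z +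
      c * ν ^ (-(ε / (2 + ε))) * E ^ (2 * ε / (5 * (2 + ε))) * X ^ ((15 + 8 * ε) / (5 * (2 + ε)))
  -- ### the modewise identity and summability of the trilinear family
  have hid : ∀ k, (inner ℂ (w k) (cf k)).re =
      -(ν * (4 * Real.pi ^ 2 * freqNormSq k)) * ‖cf k‖ ^ 2 - (inner ℂ (B k) (cf k)).re := by
    intro k
    have h1 := h.re_inner_mFourierCoeff_timeDerivWithin hU htS k
    rw [mFourierCoeff_complexify_zero_force', inner_zero_left, Complex.zero_re, add_zero] at h1
    exact h1
  set Rk : (d → ℤ) → ℝ := fun k => freqNormSq k ^ (5 / 2 : ℝ) * ‖cf k‖ * ‖B k‖ with hR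
  have hR0 : ∀ k, 0 ≤ Rk k := fun k =>
    mul_nonneg (mul_nonneg (Real.rpow_nonneg (freqNormSq_nonneg k) _) (norm_nonneg _)) (norm_nonneg _)
  have hRK : ∀ K' : Finset (d → ℤ), ∑ k ∈ K', Rk k ≤ CT * F * Real.sqrt X * Real.sqrt Z := by
    intro K'
    have h1 := sum_rpow_mul_norm_mul_norm_convect_le hut (h.divFree t htS)
      (by norm_num : (0:ℝ) ≤ 5 / 2) K'
    refine h1.trans ?_
    have h2 : Real.sqrt (∑ k ∈ K', freqNormSq k ^ ((5 / 2 : ℝ) + 1) * ‖cf k‖ ^ 2) ≤ Real.sqrt Z :=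
      Real.sqrt_le_sqrt (sum_le_hasSum K' (fun k _ => hw0 _ k) hsumZ.hasSum)
    exact mul_le_mul_of_nonneg_left h2 (mul_nonneg (mul_nonneg hCT0 hF0) (Real.sqrt_nonneg _))
  have hRs : Summable Rk := summable_of_sum_le hR0 hRK
  set Qk : (d → ℤ) → ℝ := fun k => freqNormSq k ^ (5 / 2 : ℝ) * (inner ℂ (B k) (cf k)).re with hQ
  have hQle : ∀ k, |Qk k| ≤ Rk k := fun k => by
    simp only [hQ, hR, abs_mul, abs_of_nonneg (Real.rpow_nonneg (freqNormSq_nonneg k) (5 / 2 : ℝ)),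
      mul_assoc]
    exact mul_le_mul_of_nonneg_left
      ((Complex.abs_re_le_norm _).trans ((norm_inner_le_norm (B k) (cf k)).trans
        (le_of_eq (mul_comm _ _))))
      (Real.rpow_nonneg (freqNormSq_nonneg k) _)
  have hQs : Summable Qk := Summable.of_norm_bounded hRs fun k => (Real.norm_eq_abs _).le.trans (hQle k)
  have hterm : ∀ k, freqNormSq k ^ (5 / 2 : ℝ) * (2 * (inner ℂ (w k) (cf k)).re) =
      -(8 * Real.pi ^ 2 * ν) * (freqNormSq k ^ ((5 / 2 : ℝ) + 1) * ‖cf k‖ ^ 2) - 2 * Qk k := by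
    intro k
    rw [hid k]
    simp only [hQ]
    have e : freqNormSq k ^ ((5 / 2 : ℝ) + 1) = freqNormSq k ^ (5 / 2 : ℝ) * freqNormSq k := by
      rw [Real.rpow_add' (freqNormSq_nonneg k) (by norm_num : (5 / 2 : ℝ) + 1 ≠ 0), Real.rpow_one]
    rw [e]
    ring
  have hD : ∑' k, freqNormSq k ^ (5 / 2 : ℝ) * (2 * (inner ℂ (w k) (cf k)).re) =
      -(8 * Real.pi ^ 2 * ν) * Z - 2 * ∑' k, Qk k := by
    rw [tsum_congr hterm, (hsumZ.mul_left _).tsum_sub (hQs.mul_left 2), tsum_mul_left,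
      tsum_mul_left]
  rw [hD]
  -- ### (3.6)
  have h36 : |∑' k, Qk k| ≤ C₆ * X * F₁ :=
    abs_tsum_rpow_mul_re_inner_convect_le hut (h.divFree t htS) (by norm_num : (1 : ℝ) ≤ 5 / 2)
  -- ### `F₁ ≤ C_I √Y^{1/(1+ε)} √Z^{ε/(1+ε)}` and `Y ≤ E^{2ε/5} X^{1−2ε/5}`
  have hF₁le : F₁ ≤ CI * Real.sqrt Y ^ (1 / (1 + ε)) * Real.sqrt Z ^ (ε / (1 + ε)) := by
    obtain ⟨-, hle⟩ := hCI (u t) (hut.memLp 2) (hmean t htS) hsumZ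
    have e1 : (5 / 2 + 1 - 1 - (Fintype.card d : ℝ) / 2) / (5 / 2 + 1 - (5 / 2 - ε)) =
        1 / (1 + ε) := by
      rw [hn, div_eq_div_iff (by linarith) (by linarith)]; ring
    have e2 : ((Fintype.card d : ℝ) / 2 + 1 - (5 / 2 - ε)) / (5 / 2 + 1 - (5 / 2 - ε)) =
        ε / (1 + ε) := by
      rw [hn, div_eq_div_iff (by linarith) (by linarith)]; ring
    rw [e1, e2] at hle
    have e3 : ∑' k, freqNormSq k ^ ((1 : ℝ) / 2) * ‖cf k‖ = F₁ :=
      tsum_congr fun k => by rw [← Real.sqrt_eq_rpow]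
    rw [e3] at hle
    exact hle
  have hYle : Y ≤ E ^ (2 * ε / 5) * X ^ (1 - 2 * ε / 5) := by
    have ha0 : ∀ k : d → ℤ, 0 ≤ ‖cf k‖ ^ 2 := fun k => sq_nonneg _
    have h₁ : Summable fun k : d → ℤ => freqNormSq k ^ (0 : ℝ) * ‖cf k‖ ^ 2 :=
      (hasSum_sq_norm_mFourierCoeff_complexify (hut.memLp 2)).summable.congr fun k => by
        rw [Real.rpow_zero, one_mul]
    obtain ⟨-, hle⟩ := tsum_rpow_mul_le_interpolate (d := d) ha0 (s₁ := 0) (s₂ := 5 / 2)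
      (θ := 2 * ε / 5) le_rfl (by norm_num) (by positivity) (by linarith) h₁ hsumX
    have e : 2 * ε / 5 * 0 + (1 - 2 * ε / 5) * (5 / 2) = 5 / 2 - ε := by ring
    rw [e] at hle
    have eE : ∑' k : d → ℤ, freqNormSq k ^ (0 : ℝ) * ‖cf k‖ ^ 2 = E := by
      rw [tsum_congr fun k => by rw [Real.rpow_zero, one_mul]]
      exact (hasSum_sq_norm_mFourierCoeff_complexify (hut.memLp 2)).tsum_eq
    rw [eE] at hle
    exact hle
  -- ### assemble: `2 C₆ X F₁ ≤ K E^{aE} X^{bX} Z^{q}`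
  set bX : ℝ := 1 + (1 - 2 * ε / 5) / (2 * (1 + ε)) with hbX
  set aE : ℝ := (2 * ε / 5) / (2 * (1 + ε)) with haE
  have hsY : Real.sqrt Y ^ (1 / (1 + ε)) ≤
      (E ^ (2 * ε / 5) * X ^ (1 - 2 * ε / 5)) ^ (1 / (2 * (1 + ε))) := by
    rw [Real.sqrt_eq_rpow, ← Real.rpow_mul hY0, show (1 : ℝ) / 2 * (1 / (1 + ε)) = 1 / (2 * (1 + ε)) by
      field_simp]
    exact Real.rpow_le_rpow hY0 hYle (by positivity)
  have hmain : X * F₁ ≤ CI * E ^ aE * X ^ bX * Z ^ q := by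
    have hz0 : 0 ≤ Real.sqrt Z := Real.sqrt_nonneg _
    have h1 : F₁ ≤ CI * (E ^ (2 * ε / 5) * X ^ (1 - 2 * ε / 5)) ^ (1 / (2 * (1 + ε))) *
        Real.sqrt Z ^ (ε / (1 + ε)) :=
      hF₁le.trans (mul_le_mul_of_nonneg_right (mul_le_mul_of_nonneg_left hsY hCI0)
        (Real.rpow_nonneg hz0 _))
    have e1 : (E ^ (2 * ε / 5) * X ^ (1 - 2 * ε / 5)) ^ (1 / (2 * (1 + ε))) = E ^ aE * X ^ (bX - 1) := by
      rw [Real.mul_rpow (Real.rpow_nonneg hE0 _) (Real.rpow_nonneg hX0 _), ← Real.rpow_mul hE0,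
        ← Real.rpow_mul hX0, haE, hbX]
      congr 1
      · congr 1; ring
      · congr 1; ring
    have e2 : X * X ^ (bX - 1) = X ^ bX := by
      have hb1 : bX - 1 + 1 ≠ 0 := ne_of_gt (by
        have h1 : 0 < (1 - 2 * ε / 5) / (2 * (1 + ε)) := div_pos (by linarith) (by linarith)
        rw [hbX]; linarith)
      calc X * X ^ (bX - 1) = X ^ (bX - 1) * X ^ (1 : ℝ) := by rw [Real.rpow_one, mul_comm]
        _ = X ^ bX := by rw [← Real.rpow_add' hX0 hb1]; congr 1; ring
    have e3 : Real.sqrt Z ^ (ε / (1 + ε)) = Z ^ q := by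
      rw [Real.sqrt_eq_rpow, ← Real.rpow_mul hZ0, hq]
      congr 1; field_simp
    calc X * F₁
        ≤ X * (CI * (E ^ (2 * ε / 5) * X ^ (1 - 2 * ε / 5)) ^ (1 / (2 * (1 + ε))) *
            Real.sqrt Z ^ (ε / (1 + ε))) := mul_le_mul_of_nonneg_left h1 hX0
      _ = CI * E ^ aE * (X * X ^ (bX - 1)) * Real.sqrt Z ^ (ε / (1 + ε)) := by rw [e1]; ring
      _ = CI * E ^ aE * X ^ bX * Z ^ q := by rw [e2, e3]
  have hfin : -(2 : ℝ) * ∑' k, Qk k ≤ K * E ^ aE * X ^ bX * Z ^ q := by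
    calc -(2 : ℝ) * ∑' k, Qk k ≤ 2 * |∑' k, Qk k| := by linarith [neg_abs_le (∑' k, Qk k)]
      _ ≤ 2 * (C₆ * X * F₁) := by linarith [h36]
      _ = 2 * C₆ * (X * F₁) := by ring
      _ ≤ 2 * C₆ * (CI * E ^ aE * X ^ bX * Z ^ q) := mul_le_mul_of_nonneg_left hmain (by positivity)
      _ = K * E ^ aE * X ^ bX * Z ^ q := by rw [hK]; ring
  -- ### Young: `K E^{aE} X^{bX} Z^q = (L Z)^q · M^{1−q}`, `L = 4π²ν`
  set P : ℝ := (15 + 8 * ε) / (5 * (2 + ε)) with hP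
  set L : ℝ := 4 * Real.pi ^ 2 * ν with hL
  have hL0 : 0 < L := by rw [hL]; positivity
  have hLq : 0 < L ^ q := Real.rpow_pos_of_pos hL0 q
  have hKL0 : 0 ≤ K * L ^ (-q) * E ^ aE := mul_nonneg (mul_nonneg hK0 (Real.rpow_nonneg hL0.le _))
    (Real.rpow_nonneg hE0 _)
  set M : ℝ := (K * L ^ (-q) * E ^ aE) ^ (1 / (1 - q)) * X ^ P with hM
  have hM0 : 0 ≤ M := mul_nonneg (Real.rpow_nonneg hKL0 _) (Real.rpow_nonneg hX0 _)
  have hAMGM := Real.geom_mean_le_arith_mean2_weighted hq0.le h1q0.le (mul_nonneg hL0.le hZ0) hM0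
    (by ring : q + (1 - q) = 1)
  have e3 : 1 / (1 - q) * (1 - q) = 1 := by rw [one_div, inv_mul_cancel₀ h1q0.ne']
  have e4 : P * (1 - q) = bX := by
    rw [h1q, hbX, hP]
    field_simp
    ring
  have hid2 : (L * Z) ^ q * M ^ (1 - q) = K * E ^ aE * X ^ bX * Z ^ q := by
    rw [hM, Real.mul_rpow hL0.le hZ0,
      Real.mul_rpow (Real.rpow_nonneg hKL0 _) (Real.rpow_nonneg hX0 _), ← Real.rpow_mul hKL0,
      ← Real.rpow_mul hX0, e3, Real.rpow_one, e4, Real.rpow_neg hL0.le]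
    calc L ^ q * Z ^ q * (K * (L ^ q)⁻¹ * E ^ aE * X ^ bX)
        = K * E ^ aE * X ^ bX * Z ^ q * (L ^ q * (L ^ q)⁻¹) := by ring
      _ = K * E ^ aE * X ^ bX * Z ^ q := by rw [mul_inv_cancel₀ hLq.ne', mul_one]
  -- `M = c ν^{−ε/(2+ε)} E^{2ε/(5(2+ε))} X^{P}`
  have e5 : -q * (1 / (1 - q)) = -(ε / (2 + ε)) := by
    rw [h1q, hq]; field_simp
  have e6 : aE * (1 / (1 - q)) = 2 * ε / (5 * (2 + ε)) := by
    rw [h1q, haE]; field_simp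
  have hMc : M = c * ν ^ (-(ε / (2 + ε))) * E ^ (2 * ε / (5 * (2 + ε))) * X ^ P := by
    have hP0 : 0 ≤ K * (4 * Real.pi ^ 2) ^ (-q) := mul_nonneg hK0 (Real.rpow_nonneg (by positivity) _)
    have hνq : 0 ≤ ν ^ (-q) := Real.rpow_nonneg hν.le _
    have hsplit : K * L ^ (-q) * E ^ aE = (K * (4 * Real.pi ^ 2) ^ (-q)) * ν ^ (-q) * E ^ aE := by
      rw [hL, Real.mul_rpow (by positivity : (0 : ℝ) ≤ 4 * Real.pi ^ 2) hν.le]; ring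
    rw [hM, hsplit, Real.mul_rpow (mul_nonneg hP0 hνq) (Real.rpow_nonneg hE0 _),
      Real.mul_rpow hP0 hνq, ← Real.rpow_mul hν.le, ← Real.rpow_mul hE0, e5, e6, hc]
  calc -(8 * Real.pi ^ 2 * ν) * Z - 2 * ∑' k, Qk k
      ≤ -(8 * Real.pi ^ 2 * ν) * Z + K * E ^ aE * X ^ bX * Z ^ q := by linarith [hfin]
    _ = -(8 * Real.pi ^ 2 * ν) * Z + (L * Z) ^ q * M ^ (1 - q) := by rw [hid2]
    _ ≤ -(8 * Real.pi ^ 2 * ν) * Z + (q * (L * Z) + (1 - q) * M) := by linarith [hAMGM]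
    _ ≤ -(8 * Real.pi ^ 2 * ν) * Z + (L * Z + M) := by
        nlinarith [mul_nonneg hL0.le hZ0, hM0, hq0, h1q0]
    _ = -(4 * Real.pi ^ 2 * ν) * Z +
          c * ν ^ (-(ε / (2 + ε))) * E ^ (2 * ε / (5 * (2 + ε))) * X ^ P := by
        rw [hMc, hL]
        ring


/-- **Lifespan in `Ḣ^{5/2}` up to `ε`** (Robinson–Sadowski–Silva 2012, §V.A, the case `s = 5/2`,
with (4.1)), window form on `T³`: for `card d = 3` and `0 < ε < 5/2` there is `c₁ = c₁(ε) > 0`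
such that for every `ν > 0` and every classical mean-zero solution of the unforced equations on
`[a, b] × T³` with
`(b − a) · ν^{−ε/(2+ε)} (∫‖u(a)‖²)^{2ε/(5(2+ε))} · (‖u(a)‖²_{Ḣ^{5/2}})^{(5+3ε)/(5(2+ε))} ≤ c₁`
one has `‖u(t)‖²_{Ḣ^{5/2}} ≤ 2^{5(2+ε)/(5+3ε)} ‖u(a)‖²_{Ḣ^{5/2}}` on `[a, b]` (energy decay and
comparison for `NSSobolev.hsSeminorm_sq_deriv_le_five_halves`).
[cite: RobinsonSadowskiSilva2012, §V.A with (4.1)] -/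
theorem hsSeminorm_sq_le_of_window_five_halves (hd : Fintype.card d = 3) {ε : ℝ} (hε : 0 < ε)
    (hε' : ε < 5 / 2) :
    ∃ c₁ : ℝ, 0 < c₁ ∧ ∀ {ν a b : ℝ}, 0 < ν → a < b →
      ∀ {u : ℝ → UnitAddTorus d → EuclideanSpace ℝ d} {p : ℝ → UnitAddTorus d → ℝ},
      Torus.IsClassicalNSSolutionOn (Icc a b) ν 0 u p → (∀ t ∈ Icc a b, HasZeroMean (u t)) →
      (b - a) * (ν ^ (-(ε / (2 + ε))) * (∫ x, ‖u a x‖ ^ 2) ^ (2 * ε / (5 * (2 + ε)))) *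
          (∑' k : d → ℤ, freqNormSq k ^ (5 / 2 : ℝ) *
            ‖mFourierCoeff (EuclideanSpace.complexify ∘ u a) k‖ ^ 2) ^ ((5 + 3 * ε) / (5 * (2 + ε))) ≤ c₁ →
      ∀ t ∈ Icc a b, (∑' k : d → ℤ, freqNormSq k ^ (5 / 2 : ℝ) *
          ‖mFourierCoeff (EuclideanSpace.complexify ∘ u t) k‖ ^ 2) ≤
        (2 : ℝ) ^ (5 * (2 + ε) / (5 + 3 * ε)) * ∑' k : d → ℤ, freqNormSq k ^ (5 / 2 : ℝ) *
          ‖mFourierCoeff (EuclideanSpace.complexify ∘ u a) k‖ ^ 2 := by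
  classical
  have hn : (Fintype.card d : ℝ) = 3 := by rw [hd]; norm_num
  obtain ⟨K, hK0, hK⟩ := hsSeminorm_sq_deriv_le_five_halves hd hε hε'
  set γ : ℝ := (5 + 3 * ε) / (5 * (2 + ε)) with hγ
  set θ : ℝ := 2 * ε / (5 * (2 + ε)) with hθ
  have hγ0 : 0 < γ := by rw [hγ]; positivity
  have hθ0 : 0 ≤ θ := by rw [hθ]; positivity
  have hβ : (15 + 8 * ε) / (5 * (2 + ε)) = 1 + γ := by rw [hγ]; field_simp; ring
  set c₁ : ℝ := 1 / (2 * γ * (K + 1)) with hc₁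
  have hc₁0 : 0 < c₁ := by rw [hc₁]; positivity
  refine ⟨c₁, hc₁0, fun {ν a b} hν hab {u p} h hmean hsmall t ht => ?_⟩
  set Ea : ℝ := ∫ x, ‖u a x‖ ^ 2 with hEa
  have hEa0 : 0 ≤ Ea := integral_nonneg fun x => sq_nonneg _
  have hνa : 0 ≤ ν ^ (-(ε / (2 + ε))) := Real.rpow_nonneg hν.le _
  set κ : ℝ := K * (ν ^ (-(ε / (2 + ε))) * Ea ^ θ) with hκ
  have hκ0 : 0 ≤ κ := mul_nonneg hK0 (mul_nonneg hνa (Real.rpow_nonneg hEa0 _))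
  set X : ℝ → ℝ := fun τ => ∑' k : d → ℤ, freqNormSq k ^ (5 / 2 : ℝ) *
    ‖mFourierCoeff (EuclideanSpace.complexify ∘ u τ) k‖ ^ 2 with hX
  have hXnn : ∀ τ, 0 ≤ X τ := fun τ => tsum_nonneg fun k =>
    mul_nonneg (Real.rpow_nonneg (freqNormSq_nonneg k) _) (sq_nonneg _)
  show X t ≤ (2 : ℝ) ^ (5 * (2 + ε) / (5 + 3 * ε)) * X a
  have hXc : ContinuousOn X (Icc a b) :=
    continuousOn_tsum_rpow_mul_norm_sq_of_lt 2 hab h.smooth_velocity (by norm_num)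
      (by rw [hn]; norm_num)
  -- energy decay on the window
  have hE : ∀ τ ∈ Icc a b, ∫ x, ‖u τ x‖ ^ 2 ≤ Ea := by
    intro τ hτ
    have hK' := kineticEnergy_le_of_le hν.le h (convex_Icc a b) hτ.1
      (fun r hr => ⟨hr.1, hr.2.trans hτ.2⟩)
    unfold Torus.kineticEnergy at hK'
    rw [hEa]
    linarith
  have hXd : ∀ τ ∈ Ioo a b, HasDerivAt X (deriv X τ) τ ∧ deriv X τ ≤ κ * X τ ^ (1 + γ) := by
    intro τ hτ
    obtain ⟨D, hD, hle⟩ := hK hν hab h hmean τ hτ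
    refine ⟨hD.differentiableAt.hasDerivAt, ?_⟩
    rw [hD.deriv]
    refine hle.trans ?_
    have hZ0 : 0 ≤ ∑' k : d → ℤ, freqNormSq k ^ ((5 / 2 : ℝ) + 1) *
        ‖mFourierCoeff (EuclideanSpace.complexify ∘ u τ) k‖ ^ 2 := tsum_nonneg fun k =>
      mul_nonneg (Real.rpow_nonneg (freqNormSq_nonneg k) _) (sq_nonneg _)
    have hneg : -(4 * Real.pi ^ 2 * ν) * (∑' k : d → ℤ, freqNormSq k ^ ((5 / 2 : ℝ) + 1) *
        ‖mFourierCoeff (EuclideanSpace.complexify ∘ u τ) k‖ ^ 2) ≤ 0 :=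
      mul_nonpos_of_nonpos_of_nonneg (by have := Real.pi_pos; nlinarith [hν]) hZ0
    have hEθ : (∫ x, ‖u τ x‖ ^ 2) ^ θ ≤ Ea ^ θ :=
      Real.rpow_le_rpow (integral_nonneg fun x => sq_nonneg _) (hE τ (Ioo_subset_Icc_self hτ)) hθ0
    have hmain : K * ν ^ (-(ε / (2 + ε))) * (∫ x, ‖u τ x‖ ^ 2) ^ (2 * ε / (5 * (2 + ε))) *
        X τ ^ ((15 + 8 * ε) / (5 * (2 + ε))) ≤ κ * X τ ^ (1 + γ) := by
      rw [hβ, hκ, ← hθ]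
      have h1 : K * ν ^ (-(ε / (2 + ε))) * (∫ x, ‖u τ x‖ ^ 2) ^ θ ≤
          K * (ν ^ (-(ε / (2 + ε))) * Ea ^ θ) := by
        rw [← mul_assoc]
        exact mul_le_mul_of_nonneg_left hEθ (mul_nonneg hK0 hνa)
      exact mul_le_mul_of_nonneg_right h1 (Real.rpow_nonneg (hXnn τ) _)
    linarith [hmain]
  -- the smallness condition of the abstract window lemma
  have hsm : γ * κ * (b - a) * X a ^ γ ≤ 1 / 2 := by
    have h1 : (b - a) * (ν ^ (-(ε / (2 + ε))) * Ea ^ θ) * X a ^ γ ≤ c₁ := hsmall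
    have h2 : 0 ≤ (b - a) * (ν ^ (-(ε / (2 + ε))) * Ea ^ θ) * X a ^ γ :=
      mul_nonneg (mul_nonneg (by linarith) (mul_nonneg hνa (Real.rpow_nonneg hEa0 _)))
        (Real.rpow_nonneg (hXnn a) _)
    calc γ * κ * (b - a) * X a ^ γ
        = γ * K * ((b - a) * (ν ^ (-(ε / (2 + ε))) * Ea ^ θ) * X a ^ γ) := by rw [hκ]; ring
      _ ≤ γ * (K + 1) * c₁ :=
          mul_le_mul (mul_le_mul_of_nonneg_left (by linarith) hγ0.le) h1 h2 (by positivity)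
      _ = 1 / 2 := by rw [hc₁]; field_simp
  have hres := le_rpow_mul_of_window (X := X) (X' := deriv X) hab hκ0 hγ0 (fun τ _ => hXnn τ) hXc
    (fun τ hτ => (hXd τ hτ).1) (fun τ hτ => (hXd τ hτ).2) hsm ht
  have e : (1 : ℝ) / γ = 5 * (2 + ε) / (5 + 3 * ε) := by
    rw [hγ, one_div, inv_div]
  rw [e] at hres
  exact hres

/-- **The `Ḣ^{5/2}` blow-up rate, arbitrarily close to `(T − t)^{−1}`** (Robinson–Sadowski–Silva
2012, §V.A: "We cannot quite obtain the optimal blowup rate in `Ḣ^{3/2}` (∼`t^{−1/2}`) and `Ḣ^{5/2}`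
(∼`t^{−1}`), but can get arbitrarily close"), classical torus form under unboundedness of the
`Ḣ^{5/2}` energy, in the parametrisation of `NSSobolev.hsSeminorm_sq_deriv_le_five_halves`: for
`card d = 3` and `0 < ε < 5/2` there is `c₁ = c₁(ε) > 0` such that every classical mean-zero
solution on `[a, T) × T³` (zero force, `ν > 0`) whose `Ḣ^{5/2}` energy `X` is unbounded on
`[a, T)` satisfies, for all `t ∈ [a, T)`,
`X(t) ≥ (c₁ ν^{ε/(2+ε)} / ((T − t)(∫‖u(t)‖²)^{2ε/(5(2+ε))}))^{5(2+ε)/(5+3ε)}`, i.e.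
`‖u(t)‖_{Ḣ^{5/2}} ≳ ‖u(t)‖₂^{−2ε/(5+3ε)} (T − t)^{−5(2+ε)/(2(5+3ε))}` (exponent `→ 1` as `ε → 0`).
[cite: RobinsonSadowskiSilva2012, §V.A with (4.2)] -/
theorem hsSeminorm_sq_blowup_rate_five_halves (hd : Fintype.card d = 3) {ε : ℝ} (hε : 0 < ε)
    (hε' : ε < 5 / 2) :
    ∃ c₁ : ℝ, 0 < c₁ ∧ ∀ {ν a T : ℝ}, 0 < ν →
      ∀ {u : ℝ → UnitAddTorus d → EuclideanSpace ℝ d} {p : ℝ → UnitAddTorus d → ℝ},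
      Torus.IsClassicalNSSolutionOn (Ico a T) ν 0 u p → (∀ t ∈ Ico a T, HasZeroMean (u t)) →
      ¬ BddAbove ((fun t => ∑' k : d → ℤ, freqNormSq k ^ (5 / 2 : ℝ) *
          ‖mFourierCoeff (EuclideanSpace.complexify ∘ u t) k‖ ^ 2) '' Ico a T) →
      ∀ t ∈ Ico a T,
        (c₁ / ((T - t) * (ν ^ (-(ε / (2 + ε))) * (∫ x, ‖u t x‖ ^ 2) ^ (2 * ε / (5 * (2 + ε)))))) ^
            (5 * (2 + ε) / (5 + 3 * ε)) ≤
        ∑' k : d → ℤ, freqNormSq k ^ (5 / 2 : ℝ) *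
          ‖mFourierCoeff (EuclideanSpace.complexify ∘ u t) k‖ ^ 2 := by
  classical
  have hn : (Fintype.card d : ℝ) = 3 := by rw [hd]; norm_num
  obtain ⟨c₁, hc₁0, hW⟩ := hsSeminorm_sq_le_of_window_five_halves hd hε hε'
  refine ⟨c₁, hc₁0, fun {ν a T} hν {u p} h hmean hunb t ht => ?_⟩
  set γ : ℝ := (5 + 3 * ε) / (5 * (2 + ε)) with hγ
  set θ : ℝ := 2 * ε / (5 * (2 + ε)) with hθ
  have hγ0 : 0 < γ := by rw [hγ]; positivity
  set X : ℝ → ℝ := fun τ => ∑' k : d → ℤ, freqNormSq k ^ (5 / 2 : ℝ) *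
    ‖mFourierCoeff (EuclideanSpace.complexify ∘ u τ) k‖ ^ 2 with hX
  have hXnn : ∀ τ, 0 ≤ X τ := fun τ => tsum_nonneg fun k =>
    mul_nonneg (Real.rpow_nonneg (freqNormSq_nonneg k) _) (sq_nonneg _)
  set Et : ℝ := ∫ x, ‖u t x‖ ^ 2 with hEt
  have hEt0 : 0 ≤ Et := integral_nonneg fun x => sq_nonneg _
  set Wt : ℝ := ν ^ (-(ε / (2 + ε))) * Et ^ θ with hWt
  have hWt0 : 0 ≤ Wt := mul_nonneg (Real.rpow_nonneg hν.le _) (Real.rpow_nonneg hEt0 _)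
  show (c₁ / ((T - t) * Wt)) ^ (5 * (2 + ε) / (5 + 3 * ε)) ≤ X t
  have htT : 0 < T - t := by linarith [ht.2]
  have h3ε : 0 < 5 + 3 * ε := by linarith
  by_contra hlt
  rw [not_le] at hlt
  -- then `(T - t) Wt X(t)^γ < c₁`
  have hsmall : (T - t) * Wt * X t ^ γ < c₁ := by
    rcases hWt0.eq_or_lt with h0 | hpos
    · rw [← h0, mul_zero, zero_mul]; exact hc₁0
    · have hL0 : 0 < c₁ / ((T - t) * Wt) := div_pos hc₁0 (mul_pos htT hpos)
      have h1 : X t ^ γ < ((c₁ / ((T - t) * Wt)) ^ (5 * (2 + ε) / (5 + 3 * ε))) ^ γ :=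
        Real.rpow_lt_rpow (hXnn t) hlt hγ0
      rw [← Real.rpow_mul hL0.le, show 5 * (2 + ε) / (5 + 3 * ε) * γ = 1 by
          rw [hγ, div_mul_div_comm, div_eq_one_iff_eq (ne_of_gt (by positivity))]; ring,
        Real.rpow_one] at h1
      calc (T - t) * Wt * X t ^ γ < (T - t) * Wt * (c₁ / ((T - t) * Wt)) :=
            mul_lt_mul_of_pos_left h1 (mul_pos htT hpos)
        _ = c₁ := by field_simp
  apply hunb
  have hright : ∀ τ ∈ Ico t T, X τ ≤ (2 : ℝ) ^ (5 * (2 + ε) / (5 + 3 * ε)) * X t := by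
    intro τ hτ
    rcases hτ.1.eq_or_lt with h0 | htτ
    · rw [← h0]
      have : (1 : ℝ) ≤ (2 : ℝ) ^ (5 * (2 + ε) / (5 + 3 * ε)) := Real.one_le_rpow (by norm_num) (by positivity)
      nlinarith [hXnn t]
    · set b : ℝ := (τ + T) / 2 with hb
      have hτb : τ < b := by rw [hb]; linarith [hτ.2]
      have hbT : b < T := by rw [hb]; linarith [hτ.2]
      have htb : t < b := htτ.trans hτb
      have hsub : Icc t b ⊆ Ico a T := fun r hr => ⟨ht.1.trans hr.1, lt_of_le_of_lt hr.2 hbT⟩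
      have h' : Torus.IsClassicalNSSolutionOn (Icc t b) ν 0 u p := h.mono hsub (uniqueDiffOn_Icc htb)
      have hsm : (b - t) * Wt * X t ^ γ ≤ c₁ := by
        have : (b - t) * Wt * X t ^ γ ≤ (T - t) * Wt * X t ^ γ :=
          mul_le_mul_of_nonneg_right (mul_le_mul_of_nonneg_right (by linarith) hWt0)
            (Real.rpow_nonneg (hXnn t) _)
        linarith
      exact hW hν htb h' (fun r hr => hmean r (hsub hr)) hsm τ ⟨htτ.le, hτb.le⟩
  have hleft : BddAbove (X '' Icc a t) := by
    rcases ht.1.eq_or_lt with h0 | hat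
    · rw [← h0, Set.Icc_self, Set.image_singleton]
      exact bddAbove_singleton
    · have hsub : Icc a t ⊆ Ico a T := fun r hr => ⟨hr.1, lt_of_le_of_lt hr.2 ht.2⟩
      have h' : Torus.IsClassicalNSSolutionOn (Icc a t) ν 0 u p := h.mono hsub (uniqueDiffOn_Icc hat)
      have hXc : ContinuousOn X (Icc a t) :=
        continuousOn_tsum_rpow_mul_norm_sq_of_lt 2 hat h'.smooth_velocity (by norm_num)
          (by rw [hn]; norm_num)
      exact (isCompact_Icc.image_of_continuousOn hXc).bddAbove
  obtain ⟨B₁, hB₁⟩ := hleft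
  refine ⟨max B₁ ((2 : ℝ) ^ (5 * (2 + ε) / (5 + 3 * ε)) * X t), ?_⟩
  rintro _ ⟨τ, hτ, rfl⟩
  rcases le_or_gt τ t with hτt | htτ
  · exact (hB₁ ⟨τ, ⟨hτ.1, hτt⟩, rfl⟩).trans (le_max_left _ _)
  · exact (hright τ ⟨htτ.le, hτ.2⟩).trans (le_max_right _ _)


/-! ### §8 The boundary-case rates under the classical (enstrophy) blow-up hypothesis -/

/-- `‖∇u‖₂² ≤ 4π² ∑|k|^{2s}‖û(k)‖²` for smooth `u` and `s ≥ 1` (`|k|² ≤ |k|^{2s}` off the zero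
mode). [folklore] -/
private theorem gradNormSq_le_tsum_rpow {u : UnitAddTorus d → EuclideanSpace ℝ d} (hu : IsSmooth u)
    {s : ℝ} (hs : 1 ≤ s) :
    Torus.gradNormSq u ≤ 4 * Real.pi ^ 2 * ∑' k : d → ℤ, freqNormSq k ^ s *
      ‖mFourierCoeff (EuclideanSpace.complexify ∘ u) k‖ ^ 2 := by
  classical
  have hG := hasSum_freqNormSq_mul_norm_sq_mFourierCoeff hu
  have hXs := hu.summable_freqNormSq_rpow_mul_norm_sq (by linarith : (0 : ℝ) ≤ s)
  rw [← hG.tsum_eq, ← tsum_mul_left]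
  refine Summable.tsum_le_tsum (fun k => ?_) hG.summable (hXs.mul_left _)
  rw [← mul_assoc]
  refine mul_le_mul_of_nonneg_right (mul_le_mul_of_nonneg_left ?_ (by positivity)) (sq_nonneg _)
  by_cases hk : k = 0
  · rw [hk, freqNormSq_zero, Real.zero_rpow (by linarith)]
  · calc freqNormSq k = freqNormSq k ^ (1 : ℝ) := (Real.rpow_one _).symm
      _ ≤ freqNormSq k ^ s :=
          Real.rpow_le_rpow_of_exponent_le (one_le_freqNormSq_of_ne_zero hk) hs

/-- **The `Ḣ^{3/2}` rate of §6 under unboundedness of `‖∇u‖₂`** (Robinson–Sadowski–Silva 2012,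
§V.A), classical torus form: for `card d = 3`, `0 < ε < 3/2` there is `c₁ > 0` such that every
classical mean-zero solution on `[a, T) × T³` (zero force, `ν > 0`) with `‖∇u(t)‖₂²` unbounded on
`[a, T)` satisfies the lower bound of `NSSobolev.hsSeminorm_sq_blowup_rate_three_halves` at every
`t ∈ [a, T)` (`‖∇u‖₂² ≤ 4π²‖u‖²_{Ḣ^{3/2}}` for mean-zero fields).
[cite: RobinsonSadowskiSilva2012, §V.A with (4.2)] -/
theorem hsSeminorm_sq_blowup_rate_three_halves_of_not_bddAbove_gradNormSq
    (hd : Fintype.card d = 3) {ε : ℝ} (hε : 0 < ε) (hε' : ε < 3 / 2) :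
    ∃ c₁ : ℝ, 0 < c₁ ∧ ∀ {ν a T : ℝ}, 0 < ν →
      ∀ {u : ℝ → UnitAddTorus d → EuclideanSpace ℝ d} {p : ℝ → UnitAddTorus d → ℝ},
      Torus.IsClassicalNSSolutionOn (Ico a T) ν 0 u p → (∀ t ∈ Ico a T, HasZeroMean (u t)) →
      ¬ BddAbove ((fun t => Torus.gradNormSq (u t)) '' Ico a T) →
      ∀ t ∈ Ico a T,
        (c₁ / ((T - t) * (ν ^ (-(1 + 2 * ε)) * (∫ x, ‖u t x‖ ^ 2) ^ (2 * ε / 3)))) ^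
            (3 / (3 + ε)) ≤
        ∑' k : d → ℤ, freqNormSq k ^ (3 / 2 : ℝ) *
          ‖mFourierCoeff (EuclideanSpace.complexify ∘ u t) k‖ ^ 2 := by
  classical
  obtain ⟨c₁, hc₁, H⟩ := hsSeminorm_sq_blowup_rate_three_halves hd hε hε'
  refine ⟨c₁, hc₁, fun {ν a T} hν {u p} h hmean hunb t ht => H hν h hmean ?_ t ht⟩
  intro hbdd
  apply hunb
  obtain ⟨M, hM⟩ := hbdd
  refine ⟨4 * Real.pi ^ 2 * M, ?_⟩
  rintro _ ⟨τ, hτ, rfl⟩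
  have hX : ∑' k : d → ℤ, freqNormSq k ^ (3 / 2 : ℝ) *
      ‖mFourierCoeff (EuclideanSpace.complexify ∘ u τ) k‖ ^ 2 ≤ M := hM ⟨τ, hτ, rfl⟩
  have hle := gradNormSq_le_tsum_rpow (h.smooth_velocity.isSmooth_slice hτ)
    (by norm_num : (1 : ℝ) ≤ 3 / 2)
  show Torus.gradNormSq (u τ) ≤ 4 * Real.pi ^ 2 * M
  exact hle.trans (mul_le_mul_of_nonneg_left hX (by positivity))

/-- **The `Ḣ^{5/2}` rate of §7 under unboundedness of `‖∇u‖₂`** (Robinson–Sadowski–Silva 2012,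
§V.A), classical torus form: for `card d = 3`, `0 < ε < 5/2` there is `c₁ > 0` such that every
classical mean-zero solution on `[a, T) × T³` (zero force, `ν > 0`) with `‖∇u(t)‖₂²` unbounded on
`[a, T)` satisfies the lower bound of `NSSobolev.hsSeminorm_sq_blowup_rate_five_halves` at every
`t ∈ [a, T)`. [cite: RobinsonSadowskiSilva2012, §V.A with (4.2)] -/
theorem hsSeminorm_sq_blowup_rate_five_halves_of_not_bddAbove_gradNormSq
    (hd : Fintype.card d = 3) {ε : ℝ} (hε : 0 < ε) (hε' : ε < 5 / 2) :
    ∃ c₁ : ℝ, 0 < c₁ ∧ ∀ {ν a T : ℝ}, 0 < ν →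
      ∀ {u : ℝ → UnitAddTorus d → EuclideanSpace ℝ d} {p : ℝ → UnitAddTorus d → ℝ},
      Torus.IsClassicalNSSolutionOn (Ico a T) ν 0 u p → (∀ t ∈ Ico a T, HasZeroMean (u t)) →
      ¬ BddAbove ((fun t => Torus.gradNormSq (u t)) '' Ico a T) →
      ∀ t ∈ Ico a T,
        (c₁ / ((T - t) * (ν ^ (-(ε / (2 + ε))) * (∫ x, ‖u t x‖ ^ 2) ^ (2 * ε / (5 * (2 + ε)))))) ^
            (5 * (2 + ε) / (5 + 3 * ε)) ≤
        ∑' k : d → ℤ, freqNormSq k ^ (5 / 2 : ℝ) *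
          ‖mFourierCoeff (EuclideanSpace.complexify ∘ u t) k‖ ^ 2 := by
  classical
  obtain ⟨c₁, hc₁, H⟩ := hsSeminorm_sq_blowup_rate_five_halves hd hε hε'
  refine ⟨c₁, hc₁, fun {ν a T} hν {u p} h hmean hunb t ht => H hν h hmean ?_ t ht⟩
  intro hbdd
  apply hunb
  obtain ⟨M, hM⟩ := hbdd
  refine ⟨4 * Real.pi ^ 2 * M, ?_⟩
  rintro _ ⟨τ, hτ, rfl⟩
  have hX : ∑' k : d → ℤ, freqNormSq k ^ (5 / 2 : ℝ) *
      ‖mFourierCoeff (EuclideanSpace.complexify ∘ u τ) k‖ ^ 2 ≤ M := hM ⟨τ, hτ, rfl⟩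
  have hle := gradNormSq_le_tsum_rpow (h.smooth_velocity.isSmooth_slice hτ)
    (by norm_num : (1 : ℝ) ≤ 5 / 2)
  show Torus.gradNormSq (u τ) ≤ 4 * Real.pi ^ 2 * M
  exact hle.trans (mul_le_mul_of_nonneg_left hX (by positivity))


end NSSobolev

end Literature.Analysis.FluidPDE

end
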